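import Summits.HodgeConjecture.HodgeConjecture.Theses.AnchorTransport
import Summits.HodgeConjecture.HodgeConjecture.Theorems.AnchorTransportVariationalHodgeQuasiProjective
import Summits.HodgeConjecture.HodgeConjecture.Theorems.AnchorTransportVariationalHodgeCorrespondenceTransport
import Summits.HodgeConjecture.HodgeConjecture.Theorems.AnchorTransportVariationalHodgeLefschetzRange
import Summits.HodgeConjecture.HodgeConjecture.Theorems.AnchorTransportVariationalHodgeCurveBase
import Literature.AlgebraicGeometry.Motives.CurveThroughTwoPointsProofs
import Summits.HodgeConjecture.HodgeConjecture.Theorems.AnchorTransportVariationalHodgeStubDominanceAlongSmooth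
import Literature.AlgebraicGeometry.HodgeTheory.PencilStepBelowMiddleOfVerdier
import Literature.AlgebraicGeometry.HodgeTheory.SpreadSupportsOfSmoothFamily
import Literature.AlgebraicGeometry.HodgeTheory.LefschetzOneOneHolds
import Literature.AlgebraicGeometry.HodgeTheory.HardLefschetzNFoldHolds
import Literature.AlgebraicGeometry.HodgeTheory.ClassesSupportedOn
import Literature.AlgebraicGeometry.HodgeTheory.BlochSemiregularityTheorem
import Literature.AlgebraicGeometry.HodgeTheory.FlatFamilyCycleClass
import Literature.AlgebraicGeometry.HodgeTheory.AlgebraicityLocusLinearSections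
import Literature.AlgebraicGeometry.HodgeTheory.HypersurfaceLefschetzProofs
import Literature.AlgebraicGeometry.HodgeTheory.AlgebraicClassesHodgeTypeHolds
import Summits.HodgeConjecture.HodgeConjecture.Theorems.AnchorTransportVariationalHodgePencilSweep
import Literature.AlgebraicGeometry.Motives.CompleteIntersection
import Literature.AlgebraicGeometry.Motives.ChernClassesProofs
import Literature.AlgebraicGeometry.Deformation.SquareZeroExtensionObstruction
import Summits.HodgeConjecture.HodgeConjecture.Theorems.AnchorTransportVariationalHodgeHDirection
import Summits.HodgeConjecture.HodgeConjecture.Theorems.AnchorTransportVariationalHodgeStubCarriesClassOfCycleClass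
import Literature.AlgebraicGeometry.Motives.ProjectiveClosedSetsForms
import Summits.HodgeConjecture.HodgeConjecture.Theorems.AnchorTransportVariationalHodgeStubThomasDescentOfSweep
import Summits.HodgeConjecture.HodgeConjecture.Theorems.AnchorTransportVariationalHodgePolarPatchReach

/-!
# Line `polar-patch-broken-cycles` — skeleton for crux `VariationalHodge` (stmt-HodgeConjecture-1076)

## STATUS in the lead's cycle 4 (prover-line-stmt-HodgeConjecture-1076-c4-0, 2026-08-17) — GENERATION 8

THE COMPOSITION IS NOW A THEOREM OF THE TREE: `Theorems/AnchorTransportVariationalHodgePolarPatchReach.lean` (p156143,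
this lead) proves `Theorems.polarPatch_vhcTwo_four` and `Theorems.polarPatch_vhcTwo_all` (registered stubs, LANDED: the bet →
Bloch's fact → Fulton's fact → `V₂` on quasi-projective total spaces over smooth irreducible affine bases, `n = 4` / every `n`)
and `Theorems.variationalHodge_of_polarPatchInputs` (the same three inputs → C₂ → C₃ → `AnchorTransport.VariationalHodge`, via
the strategist's glue `variationalHodge_of_codimSplit`, p153169). So the skeleton's §4 below is a ONE-LINE application of the
tree: `VariationalHodge_of := Theorems.variationalHodge_of_polarPatchInputs hS1b hS1a hS2a hC2 hC3`, and the line's reach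
`VariationalHodgeTwoAffineAll_of := Theorems.polarPatch_vhcTwo_all hS1b hS1a hS2a`. OPEN registered stubs (the only `sorry`s,
unchanged): S1a `stub_bloch1972Lifts` (named fact, tier-0 literature debt), S1b `stub_semiregularBrokenRepresentative` (THE BET;
lead; cycle-4 analysis `Lines/polar-patch-broken-cycles-S1b-arenas-c4.md`: on hyperkähler fourfolds of K3^[2] type the
`c₂`-slice is EXCLUDED and the rest is pinned to `h¹(N) = 1`, as on cubics), S2a `stub_flatFamilyCycleClass` (named fact,
tier-0 literature debt), C₂ `stub_twoProperResidual`, C₃ `stub_higherCodimResidual` (CODIM-SPLIT children, to be PROMOTED).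

## STATUS in the lead's cycle 3 (prover-line-stmt-HodgeConjecture-1076-c3-0, 2026-08-17) — GENERATION 7

RESHAPE of the residual only: S5 `stub_residualOffPolarScope` (the crux verbatim off the scope `p = 2 ∧ quasi-projective
total space`) is CUT INTO THE STRATEGIST'S TWO CODIM-SPLIT CHILDREN, spelled VERBATIM as in
`Cruxes/VariationalHodge/AnchorTransportVariationalHodgeCodimSplit.lean` / `CODIM-SPLIT.md` (cstrat-…-r1, 2026-08-17):
C₂ `stub_twoProperResidual` (`p = 2`, NON-quasi-projective total space — the inlined `¬ ∃ P j, IsProjectiveOver P ∧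
IsOpenImmersion j.left` —, `n ≥ 4`, smooth irreducible affine curve bases: the decl's modelling residue, Atiyah-flop families) and
C₃ `stub_higherCodimResidual` (`3 ≤ p ≤ n - 2`, smooth irreducible affine curve bases: the open remainder of Grothendieck's
conjecture). Proved glue `residualOffPolarScope_of_children` / `residualOffPolarScope_iff_children` (the cut is lossless), and the
three-way certificate `variationalHodge_iff_threeChildren : VariationalHodge ↔ C₁ ∧ C₂ ∧ C₃` with `C₁ = VariationalHodgeTwoAffineAll`
(the line's residual-free reach, = the strategist's child `VariationalHodgeTwoQuasiProjective` up to `Iff.rfl`). Purpose: the two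
residual stubs are now EXACTLY the children a planner promotes (`route edit --split VariationalHodge`, package CODIM-SPLIT.md), and the
line proper is `C₁ ⟸ S1a + S1b + S2a` (`VariationalHodgeTwoAffineAll_of`). OPEN registered stubs (the only `sorry`s): S1a
`stub_bloch1972Lifts` (named fact), S1b `stub_semiregularBrokenRepresentative` (THE BET; lead), S2a `stub_flatFamilyCycleClass`
(named fact), C₂ `stub_twoProperResidual`, C₃ `stub_higherCodimResidual` (crux-sized children, carried so that `VariationalHodge_of`
concludes the crux BY NAME; to be PROMOTED, not delegated).

## STATUS at the end of the lead's cycle 2 (prover-line-stmt-HodgeConjecture-1076-c2-0, 2026-08-17) — GENERATION 6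

S4b `Theorems.stub_thomasDescentOfSweep` LANDED (wave 1 of cycle 2, worker w-thomas, product-base universal
hyperplane-section route: ten Literature files `Motives/UniversalHyperplaneSectionFamily*.lean`,
`GoodPencilThroughOpen`, `SmoothProjectiveFamilyOverOpen`, `HodgeTheory/HyperplaneSectionFamilyGoodFibres` and the
Theorems file `AnchorTransportVariationalHodgeStubThomasDescentOfSweep.lean`), consumed by the proved glue
`thomasDescentOfSweep_landed`: the whole FRAME of the line is now closed — Lefschetz range, curve-base reduction,
dominance, carry (modulo Fulton's fact), sweep, H-direction and Thomas's descent are theorems of the tree. OPEN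
registered stubs (the only `sorry`s): S1a `stub_bloch1972Lifts` (named fact), S1b
`stub_semiregularBrokenRepresentative` (THE BET), S2a `stub_flatFamilyCycleClass` (named fact), S5
`stub_residualOffPolarScope` (crux verbatim off scope). I.e. `V₂` on quasi-projective total spaces, in EVERY
relative dimension, now follows from Bloch 1972 + Fulton's flat-family cycle class + the bet.

## STATUS at the start of the lead's cycle 2 — GENERATION 5

Two stubs of generation 4 LANDED at the end of cycle 1 and are now the tree's theorems, consumed here by
proved glue: S2b `Theorems.stub_carriesClassOfCycleClass` (p139363; glue `carriesClassOfCycleClass_landed`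
extracts the patch set `P` from `HasPolarFamily`) and S4h `Theorems.stub_hDirection` (p139049; the
`H`-direction of Thomas's descent, glue `hDirection_landed`). OPEN registered stubs (the only `sorry`s):
S1a `stub_bloch1972Lifts` (named fact), S1b `stub_semiregularBrokenRepresentative` (THE BET, lead's stub),
S2a `stub_flatFamilyCycleClass` (named fact), S4b `stub_thomasDescentOfSweep` (gen 4: GIVEN the sweep AND the
`H`-direction — what remains is the `s`-direction: relative hyperplane sections + generic choices + the Bertini
pencil `Motives.pencil_through_regularHyperplaneSection`), S5 `stub_residualOffPolarScope` (crux verbatim off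
scope; not a lemma, not delegated).

## STATUS after the lead's cycle 1 (prover-line-stmt-HodgeConjecture-1076-c1-0, 2026-08-17) — GENERATION 3

Registered stubs (the only `sorry`s): S1a `stub_bloch1972Lifts` (= named fact
`HodgeTheory.Bloch1972_semiregularSubschemeLifts`), S1b `stub_semiregularBrokenRepresentative` (THE BET, absolute:
one fourfold `X₀ ⊆ ℙᴺ`, one NON-AMBIENT rational `(2,2)` algebraic class ⇒ a Bloch-semiregular broken-cycle
representative; §2b), S2a `stub_flatFamilyCycleClass` (= named fact `HodgeTheory.fulton1998_flatFamily_cycleClass_specialises`,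
p137341), S2b `stub_carriesClassOfCycleClass` (provable now, wave 2), S4b `stub_thomasDescentOfSweep` (blocked: RELATIVE
hyperplane sections of a smooth projective family), S5 `stub_residualOffPolarScope` (the crux verbatim in the middle
range off scope — not a lemma; route-split candidate). LANDED: S3 `Theorems.stub_dominanceAlongSmooth` (p135546), S4a
`Theorems.stub_pencilSweep` (p137114). PROVED GLUE: `polarLiftOfBloch_of_absolute` (bet + Bloch ⇒ polar family),
the AMBIENT case of the fourfold statement (rigidity + moving lemma, in `vhcTwoAffine_four`), `vhcTwoAffine_of_le_three`,
the middle-range/Lefschetz-range composition. The paragraphs below record the successive reshapes.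

## Lead's reshape (line lead prover-line-stmt-HodgeConjecture-1076-c1-0, cycle 1, 2026-08-17) — generation 2

The tree moved after generation 1 was written (2026-08-16 ~12Z): the named facts
`lefschetzOneOne_rational`, `nonempty_hardLefschetzNFold` (`…Holds.lean`),
`charlesSchnell_algebraicityLocus_iUnion_closed` and `mumford_smoothCurve_through_two_points` are now
DISCHARGED theorems of the tree (axioms `propext`/`Classical.choice`/`Quot.sound`), so two stubs of
generation 1 contained provable-now parts, which a stub must not (a stub is landed whole or not at all):
* S4 `ReductionToFourfoldsTwo` is now ONLY Thomas's hyperplane descent `n ≥ 5 ⇒ n = 4` — the cases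
  `n ≤ 3` are free (`vhcTwoAffine_of_le_three`: `Theorems.variationalHodge_of_dim_le_three` fed with
  the discharged Lefschetz facts) and are moved into the glue;
* S5 `ResidualOffPolarScope` is now ONLY the honest open remainder of Grothendieck's conjecture off the
  line's scope: codimensions `2 ≤ p ≤ n - 2` with `¬ (p = 2 ∧ IsQuasiProjectiveOver 𝒳)` — i.e.
  `3 ≤ p ≤ n - 2`, and `p = 2` on NON-quasi-projective total spaces (the crux's standing modelling
  residue); `p ≤ 1` and `p ≥ n - 1` are free (`Theorems.variationalHodge_conclusion_of_lefschetzRange`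
  with the discharged facts) and enter the composition through `Theorems.variationalHodge_of_middleRange`.
  S5 stays what generation 1 said it is: NOT a lemma of this line but the crux verbatim off scope,
  carried only so that `VariationalHodge_of` concludes the crux BY NAME; it is not delegated to a
  worker; its promotion (route split of `VariationalHodge` by codimension with the quasi-projectivity
  repair) is the standing recommendation of this line's planner and of prover seats -2/0.
* S3 `DominanceAlongSmooth` is unchanged and is now provable UNCONDITIONALLY
  (`Theorems.dominanceForm_of_isQuasiProjectiveOver` p108415 + `charlesSchnell_…_holds` + openness of
  smooth morphisms + Nullstellensatz lift) — waved to a worker this cycle.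
* S1 `PolarAnchoredLifting` (the lever, lead's stub) and S2 `FlatFamilyCarriesClass` are unchanged in
  this registration; the line card's §Requests were delivered meanwhile
  (`HodgeTheory.Bloch1972_semiregularSubschemeLifts`, `HodgeTheory.BlochSemiregularSpread`,
  `HodgeTheory.IsBlochSemiregular` on real carriers), so the lead's work on S1 this cycle is to put the
  card's bet `C⁺` (asymptotic polar semiregularity) verbatim BEHIND S1:
  `S1 ⟸ Bloch1972_semiregularSubschemeLifts + C⁺ + representative step` (generation 2).

Route `AnchorTransport` (primary; the crux is shared with `KuznetsovCYFactory.VariationalHodgeSmooth`),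
crux #2 `Summit.HodgeConjecture.HodgeConjecture.Theses.AnchorTransport.VariationalHodge`
(Grothendieck's variational Hodge conjecture, global-class form: `f : 𝒳 ⟶ S` a smooth projective
family over a smooth irreducible base, `A ∈ H²ᵖ(𝒳(ℂ); ℂ)` fibrewise rational of type `(p,p)`,
algebraic on ONE fibre ⇒ algebraic on EVERY fibre). Idea card
`Cruxes/VariationalHodge/Ideas/polar-patch-broken-cycles.md` (crux-ideate r1, ideator 2; triage
r1-1/2/3: pass/pass/pass, merged with the `Z₀`-side lever of `nodal-carrier-equisingular-transport`).
Crux-plan generation 1 (planner-cruxplan-stmt-HodgeConjecture-1076-polar-patch-broken-c-0, 2026-08-16).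
Line card: `Lines/polar-patch-broken-cycles.md`.

## The line (card + triage sharpenings)

The crux hands the prover one thing — an ALGEBRAIC representative of `A|_{𝒳_{s₀}}` at the anchor —
and the one general engine, semiregularity (Bloch 1972; Buchweitz–Flenner 2003 Thm 5.1/5.2; Pridham;
Perry 2026), transports algebraicity from a SEMIREGULAR representative, which "general principles do
not give, even modulo an ample class, excepted in the case of divisors" (Voisin, Torino L3 §0). The
card's lever is a candidate general principle of exactly the missing kind, in the crux's first open
arena `(n, p) = (4, 2)` (surfaces in fourfolds — the middle dimension `n = 2p`, the only one in which the
forced singular locus `Σ = Sing G ∩ Z₀` is finite and misses the interface): break the anchor cycle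
along an ample curve section and PATCH — `W = Z₀ ∪_B C`, `B = Z₀ ∩ H₁`, `H₁ ∈ |kH|` general, `C` a
complete-intersection surface inside the threefold `X ∩ H₁` through `B` (primary construction:
`C = G ∩ H₁`, `G ⊇ Z₀` a hypersurface section of MINIMAL degree `d₀`, `k → ∞` — REVERSED asymptotics
w.r.t. Thomas 2005 §5, whose regime `deg G → ∞` is provably inert; variant: several patches
`C_j = X ∩ H₁ ∩ G_j`, `G_j ⊇ B` with PRESCRIBED polar tangencies, absorbing all of `H¹(N_{Z₀})` at the
price of forced nodes on the `C_j`). The bet `C⁺` (ASYMPTOTIC POLAR SEMIREGULARITY, one fourfold, no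
base): Bloch's map `π_W : H¹(W, N_W) → H³(X, Ω¹_X)` is INJECTIVE for `k ≥ k₀` (triage r1-2: injectivity,
not "on the obstruction span"); then Bloch / BF Thm 5.2 deform `W` sideways wherever `[W] = A + [C]`
stays Hodge — everywhere on `S`, `[C]` being ambient — and the flat family of broken cycles carries
`A`. Triage (R): the primary construction is inert on the `Z₀`-side outside the regime
`R = {H¹(Z₀, K_X(d₀)|_{Z₀}) ≠ 0}` (planes, CI and ACM anchors — and liaison never leaves it), where
only the prescribed-tangency variant is live; (A): an honest first arena must be named — line card
§First computations (Duque–Villaflor fake linear cycles on the Fermat sextic fourfold; anchors in `R`).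

## Why the line is typed in HILBERT-SCHEME FORM (and not through semiregular sheaves)

The tree's semiregularity is REAL only for finite locally free SHEAVES (`IsZeroOneSemiregular`,
`sigmaHigher`: injectivity on all of `Ext²(E, E)`); there is no Bloch map of a SUBSPACE
(`H¹(W, N_W) → H³(Ω¹_X)`, BF Def 4.10 / Prop 8.2: injectivity only on the image of
`T²_{W/X} = H¹(N_W)`), no normal sheaf and no cycle class map (`algebraicClasses` = classes supported
in codimension `≥ p`). The two notions DIFFER exactly here, and decisively for this line: by
Riemann–Roch `χ(𝒪_W, 𝒪_W) = Σ (−1)ⁱ extⁱ_X(𝒪_W, 𝒪_W) = ∫_X ch(𝒪_W)^∨ ch(𝒪_W) td_X = [W]·[W]`, and for the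
patched cycle `[W] = [Z₀] + d₀k·h²`, so `χ ~ d₀²k²·deg X → ∞`, while `ext⁰ = h⁰(𝒪_W)` and
`ext⁴ = h⁰(W, K_X|_W)` (Serre duality) are `O(k)`; hence `ext²_X(𝒪_W, 𝒪_W) → ∞` with `k`, and `𝒪_W`
(the object BF Thm 5.1 would deform) can NEVER be a semiregular SHEAF for `k ≫ 0` — its `Ext²` cannot
inject into the fixed `H^{0,2}(X) ⊕ H^{1,3}(X)` (nor is this expected of `𝓘_W` or of the syzygy bundles
of `𝓘_W`, whose `Ext²` contain the same deformation-theoretically irrelevant pieces `H⁰(det N_W)`,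
`H²(𝒪_W)`), although `W` may well be a semiregular SUBSPACE (a condition on `H¹(N_W)` alone, where
every `Z₀`/interface/patch term is `O(1)` in `k`, triage r1-1/r1-2). Feeding this line to
`BuchweitzFlenner2003_variationalHodge_semiregular` (Thm 5.1, sheaves) would therefore mis-transcribe
it. Instead the skeleton cuts the line at the two statements Bloch's theorem FACTORS
through, both typable on real carriers today (closed subschemes, conormal sheaves, flatness, Zariski
opens, supported classes): the POLAR LIFT (S1: the patched representative sits in a FLAT family over
a smooth neighbourhood of the anchor — semiregularity's deformation-theoretic output) and the CARRY
(S2: flat families of codimension-2 subschemes carry the anchored class). Definition/fact requests for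
Bloch's subspace semiregularity (`π_Z` for lci `Z`, BF Prop 8.2) and for Bloch 1972 / BF Thm 5.2 on the
family carriers are filed with the line (line card §Requests), so that generation 2 can register `C⁺`
verbatim as the stub BEHIND S1.

## THE FIVE STUBS (`theorem stub_<name> : <Def, unfolded> := by sorry`)

* S1 `stub_polarAnchoredLifting` — THE LEVER (hardest): for a family of fourfolds (quasi-projective
  total space, smooth irreducible affine base) and an anchored fibrewise-Hodge class `A`, after a
  SMOOTH base change `V → S` through `s₀` there is a POLAR FAMILY (`HasPolarFamily`): an integral lci
  surface `W₀` in the anchor fibre carrying `m·A|_{s₀}` modulo an ambient class, a transverse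
  hypersurface `V(h) ⊉ W₀`, patches `C_j = X₀ ∩ V(h, q_j)` through `B = W₀ ∩ V(h)`, each irreducible of
  codimension `2`, and a closed subscheme `𝒲 ⊂ 𝒳_V` FLAT over `V` whose fibre at `v₀` is the broken
  cycle `W₀ ∪ ⋃ C_j` scheme-theoretically. (= representative step + polar patch + `C⁺` + Bloch.)
* S2 `stub_flatFamilyCarriesClass` — THE ENGINE, geometric half (classical, size L–XL on real
  carriers: cycle classes of flat families are flat sections; `H⁴_{W₀}(X₀) = ℂ·[W₀]`): a polar family
  makes `A` algebraic on every fibre over a Zariski neighbourhood of `v₀` in `V`.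
* S3 `stub_dominanceAlongSmooth` — THE ENGINE, closing half (PROVABLE NOW, size S–M): algebraic at the
  fibres over the image of a non-empty open of a smooth `V → S` ⇒ algebraic everywhere
  (`Theorems.variationalHodge_dominance_of_open` modulo `charlesSchnell_algebraicityLocus_iUnion_closed`
  and `mumford_smoothCurve_through_two_points`, plus openness of smooth maps / Chevalley).
* S4 `stub_reductionToFourfoldsTwo` — `V₂` (quasi-projective total space, affine base) in relative
  dimension `4` ⇒ in every relative dimension `n ≥ 5`: Thomas's hyperplane descent
  `VHC(n,2) ⇐ VHC(n−1,2)` (`2p < n`), classical, size L–XL (lead's reshape: `n ≤ 3` is free,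
  `vhcTwoAffine_of_le_three`, and left the stub).
* S5 `stub_residualOffPolarScope` — the crux OFF the scope `p = 2 ∧ IsQuasiProjectiveOver 𝒳` in the
  middle range `2 ≤ p ≤ n - 2`: NOT A LEMMA OF THIS LINE (`3 ≤ p ≤ n − 2` is the open remainder of
  Grothendieck's conjecture; `p = 2` on non-quasi-projective total spaces is the crux's standing
  modelling residue — Atiyah-flop families, `Theorems.AnchorTransportVariationalHodgeQuasiProjective`,
  prover verdict-misstated 2026-08-16; lead's reshape: `p ≤ 1`, `p ≥ n - 1` are free and left the
  stub). Carried ONLY so that `VariationalHodge_of` concludes the crux BY NAME (as generation 2 of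
  `gorenstein-ci-seeds` carried its residual); NOT delegated; the residual-free scope theorem
  `VariationalHodgeTwoAffineAll_of : S1 → S2 → S3 → S4 → ∀ n, VHCTwoAffine n` is proved alongside
  (`--crux-decl …PolarPatchBrokenCycles.VariationalHodgeTwoAffineAll`). RECOMMENDATION to the route
  planner: `route edit --split VariationalHodge` by codimension with the quasi-projectivity repair,
  after which S5 leaves the skeleton.

Composition `VariationalHodge_of` (no `sorry` outside the stubs): `Theorems.variationalHodge_of_middleRange`
(unconditional) reduces to `2 ≤ p ≤ n - 2`; `by_cases` on the scope; in scope the landed fact-free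
`Q`-stable reduction to affine bases (`Theorems.variationalHodge_of_affine_of_stable`,
`Q := IsQuasiProjectiveOver`) fed with the all-`p` affine statement (Lefschetz range free, `p = 2` the
line through S4 ∘ fourfold case, other middle-range `p` the residual S5); the fourfold case
`vhcTwoAffine_four` is S1 → S2 → S3 through the landed base-change invariance
`Theorems.map_fiberι_familyPullback_mem_algebraicClasses_iff`.

## Disproof used

`Cruxes/VariationalHodge/Disproof.lean` (cdisprove cycle 1) and the landed
`Theorems/VariationalHodge/Negative/AnchorLoadBearing.lean` (p98295; read, not imported — the farm
snapshot had not built it at 12:40Z): no `_false_without_<H>` theorem exists or can exist short of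
`¬ HodgeConjecture` (`hodgeConjecture_imp`); `withoutAnchor_iff_hodgeConjecture` (the anchor carries all
content): HONOURED — S1 consumes exactly the anchor (`A|_{s₀} ∈ algebraicClasses`) to build `W₀`, and the
whole line is representative surgery AT the anchor; `sketchStub_of_hodgeConjecture` / dead line `Sketch`
(costume p96133): no stub quantifies over abstract transport operators — S1 outputs a concrete flat
family of subschemes with prescribed polar central fibre (not implied by `HodgeConjecture`: HC yields
some dominant Hilbert component, not one through a polar-patched irreducible-lci point), S2/S3 are
classical; base hypotheses are used only through S3 (irreducibility) and the smooth base change of S1.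
No landed Negative lemma refutes an instance of S1–S5 (all `HodgeConjecture`-compatible).
-/

noncomputable section

-- every declaration of this crux lives in `Summit.HodgeConjecture.HodgeConjecture.…` (summit = sub-problem)
set_option linter.dupNamespace false

open CategoryTheory CategoryTheory.Limits AlgebraicGeometry TopologicalSpace
open Literature.AlgebraicGeometry.Motives Literature.AlgebraicGeometry.HodgeTheory
open Literature.AlgebraicGeometry.Deformation (conormalSheaf)
open Summit.HodgeConjecture.HodgeConjecture.Theses.AnchorTransport
open Summit.HodgeConjecture.HodgeConjecture.Theorems

namespace Summit.HodgeConjecture.HodgeConjecture.Cruxes.VariationalHodge.PolarPatchBrokenCycles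

-- the grading of `ℂ[x₀,…,x_N]` by degree (as in `Motives/CompleteIntersection`), for `ProjectiveSpectrum.zeroLocus`
attribute [local instance] MvPolynomial.gradedAlgebra

/-! ## §1 Vocabulary: scope, `V₂` over affine bases, projective zero loci, POLAR FAMILIES -/

/-- The SCOPE of the line inside the crux: codimension `p = 2` and quasi-projective total space (with
it the proper family is projective in Hartshorne's sense,
`Theorems.exists_isClosedImmersion_of_isSmoothProjectiveFamily`, and the anchor fibre embeds in the
ambient `ℙᴺ` of the total space). -/
def InPolarScope (p : ℕ) (𝒳 : SchemeOver ℂ) : Prop :=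
  p = 2 ∧ IsQuasiProjectiveOver 𝒳

/-- **`V₂` over affine bases**: the crux `VariationalHodge` restricted to `p = 2`, to quasi-projective
total spaces and to smooth irreducible AFFINE bases, in relative dimension `n` (the shape produced by
the landed reduction `Theorems.variationalHodge_of_affine_of_stable` with `Q := IsQuasiProjectiveOver`). -/
def VHCTwoAffine (n : ℕ) : Prop :=
  ∀ ⦃𝒳 S : SchemeOver ℂ⦄ (f : 𝒳 ⟶ S), IsSmoothProjectiveFamily f n → IsQuasiProjectiveOver 𝒳 →
    IrreducibleSpace S.left → IsAffine S.left → AlgebraicGeometry.Smooth S.hom →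
    ∀ (A : complexBetti 𝒳 (2 * 2)),
    (∀ s : ComplexPoints S, IsRationalClass (complexBetti.map (fiberι f s) (2 * 2) A) ∧
      IsOfHodgeType n (fiberOver f s) (2 * 2) 2 2 (complexBetti.map (fiberι f s) (2 * 2) A)) →
    (∃ s₀ : ComplexPoints S,
      complexBetti.map (fiberι f s₀) (2 * 2) A ∈ algebraicClasses (fiberOver f s₀) 2) →
    ∀ s : ComplexPoints S,
      complexBetti.map (fiberι f s) (2 * 2) A ∈ algebraicClasses (fiberOver f s) 2

/-- The line's residual-free reach: `V₂` over affine bases in EVERY relative dimension. -/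
def VariationalHodgeTwoAffineAll : Prop :=
  ∀ n : ℕ, VHCTwoAffine n

/-- The projective zero locus `V₊(T) ⊆ ℙᴺ_ℂ` of a set of polynomials, as a set of points of the
tree's `projectiveSpace N ℂ = Proj ℂ[x₀,…,x_N]` (Mathlib `ProjectiveSpectrum.zeroLocus`). -/
def projZero (N : ℕ) (T : Set (MvPolynomial (Fin (N + 1)) ℂ)) : Set (projectiveSpace N ℂ).left :=
  letI := MvPolynomial.gradedAlgebra (σ := Fin (N + 1)) (R := ℂ)
  (ProjectiveSpectrum.zeroLocus (MvPolynomial.homogeneousSubmodule (Fin (N + 1)) ℂ) T :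
    Set (ProjectiveSpectrum (MvPolynomial.homogeneousSubmodule (Fin (N + 1)) ℂ)))

/-- **A POLAR FAMILY for the class `A` at the anchor, after the base change `π : V ⟶ S`, at `v₀ ∈ V(ℂ)`**
(lead's reshape gen 2: BLOCH'S OUTPUT SHAPE — the polar data lives on the ORIGINAL anchor fibre
`X₀ := 𝒳_{π v₀}` of `f`, the flat family on the base change `𝒳 ×_S V → V`, with central fibre IDENTIFIED
with the broken cycle through an isomorphism compatible with the two monomorphisms into `𝒳`, exactly as
`HodgeTheory.Bloch1972_semiregularSubschemeLifts` outputs it). Data and conditions, in order: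
* `e : 𝒳 ⟶ ℙᴺ` a morphism (in the composition: the embedding of the quasi-projective total space;
  `φ := X₀ ⟶ 𝒳 ⟶ ℙᴺ`; every `e^*u` is a GLOBAL class algebraic on every fibre);
* THE ANCHOR SURFACE `W₀ ↪ X₀`: a closed immersion from an INTEGRAL scheme, local complete intersection
  (conormal sheaf finite locally free), every point of codimension `≥ 2` in `X₀` and one of codimension
  exactly `2`;
* THE CLASS: `m·A|_{X₀} − φ^*u` is supported on `W₀` (`= λ·[W₀]` by purity) for a rational `m ≠ 0` and an
  ambient `u ∈ H⁴(ℙᴺ(ℂ))`;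
* THE POLAR PATCH: forms `h` (degree `k ≥ 1`, NOT containing `W₀`) and `q_j` (`j < J`) with
  `B := W₀ ∩ V(h) ⊆ V(q_j)`, each patch `C_j := X₀ ∩ V(h) ∩ V(q_j)` IRREDUCIBLE with every point of
  codimension `≥ 2`; (gen 2) the classes supported on the patch union `⋃ C_j` are AMBIENT, i.e.
  restrictions `φ^*u'` (Fulton Prop. 7.1 positivity + purity, on the nose);
* THE BROKEN CYCLE `Z₀ ↪ X₀` (gen 2): ONE closed subscheme with ideal `𝓘_{W₀} ⊓ ⨅_j 𝓘_{C_j}` (`𝓘_{C_j}`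
  the ideal of the base change to `X₀` of the reduced complete intersection `V₊(h, q_j) ↪ ℙᴺ`,
  `Motives.completeIntersectionι`) and underlying set `W₀ ∪ ⋃ C_j` — multiplicity one along `W₀`, no
  embedded junk;
* THE FLAT FAMILY (gen 2, Bloch's shape): a closed subscheme `𝒲 ⊆ 𝒳 ×_S V`, FLAT over `V`, and an
  isomorphism `ε : 𝒲 ×_{𝒳 ×_S V} (𝒳 ×_S V)_{v₀} ≅ Z₀` under which
  `𝒲_{v₀} → 𝒲 → 𝒳 ×_S V → 𝒳` is `Z₀ → X₀ → 𝒳`.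
`J = 0` (no patch: `W₀` itself deforms) and `m·A|_{X₀}` ambient (then any `W₀`) are allowed and harmless.
[Bloch 1972 Invent. Math. 17 (Thm (7.1), proof of (7.4)); BuchweitzFlenner2003 Def 4.10, Thm 5.2, Prop 8.2,
§7; Fulton 1998 Prop. 7.1; card polar-patch-broken-cycles §Lever] -/
def HasPolarFamily {𝒳 S V : SchemeOver ℂ} (f : 𝒳 ⟶ S) (A : complexBetti 𝒳 (2 * 2))
    (π : V ⟶ S) (v₀ : ComplexPoints V) : Prop :=
  ∃ (N : ℕ) (e : 𝒳 ⟶ projectiveSpace N ℂ)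
    -- the anchor surface `W₀ ↪ X₀ = 𝒳_{π v₀}`: integral, lci, of codimension two
    (W₀ : Scheme) (i₀ : W₀ ⟶ (fiberOver f (AlgPoints.map π v₀)).left) (_ : IsClosedImmersion i₀)
    (_ : IsIntegral W₀) (_ : IsFiniteLocallyFree (conormalSheaf i₀))
    (_ : ∀ w : W₀, (2 : ℕ∞) ≤ Order.coheight (i₀.base w))
    (_ : ∃ w : W₀, Order.coheight (i₀.base w) = 2)
    -- the class: `m • A|_{X₀} - φ^* u` is supported on `W₀`
    (m : ℚ) (_ : m ≠ 0) (u : complexBetti (projectiveSpace N ℂ) (2 * 2))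
    (_ : (m : ℂ) • complexBetti.map (fiberι f (AlgPoints.map π v₀)) (2 * 2) A -
          complexBetti.map (fiberι f (AlgPoints.map π v₀) ≫ e) (2 * 2) u ∈
        classesSupportedOn (fiberOver f (AlgPoints.map π v₀)) (Set.range i₀.base) (2 * 2))
    -- the polar patch: transverse hypersurface `V(h) ⊉ W₀`, patches `V(h, q j)` through `B = W₀ ∩ V(h)`
    (J k : ℕ) (d : Fin J → ℕ) (h : MvPolynomial (Fin (N + 1)) ℂ) (q : Fin J → MvPolynomial (Fin (N + 1)) ℂ)
    (_ : 0 < k) (_ : ∀ j, 0 < d j) (_ : h.IsHomogeneous k) (_ : ∀ j, (q j).IsHomogeneous (d j))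
    (_ : ∃ w : W₀, (fiberι f (AlgPoints.map π v₀) ≫ e).left.base (i₀.base w) ∉ projZero N {h})
    (_ : ∀ (j : Fin J) (w : W₀), (fiberι f (AlgPoints.map π v₀) ≫ e).left.base (i₀.base w) ∈ projZero N {h} →
          (fiberι f (AlgPoints.map π v₀) ≫ e).left.base (i₀.base w) ∈ projZero N {q j})
    (_ : ∀ j : Fin J, IsIrreducible
          ((fiberι f (AlgPoints.map π v₀) ≫ e).left.base ⁻¹' (projZero N {h} ∩ projZero N {q j})))
    (_ : ∀ (j : Fin J) (x : (fiberOver f (AlgPoints.map π v₀)).left),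
          (fiberι f (AlgPoints.map π v₀) ≫ e).left.base x ∈ projZero N {h} ∩ projZero N {q j} →
          (2 : ℕ∞) ≤ Order.coheight x)
    -- (gen 2) the patch classes are AMBIENT
    (_ : classesSupportedOn (fiberOver f (AlgPoints.map π v₀))
          {x | (fiberι f (AlgPoints.map π v₀) ≫ e).left.base x ∈ projZero N {h} ∧
            ∃ j : Fin J, (fiberι f (AlgPoints.map π v₀) ≫ e).left.base x ∈ projZero N {q j}} (2 * 2) ≤
        LinearMap.range (complexBetti.map (fiberι f (AlgPoints.map π v₀) ≫ e) (2 * 2)).hom)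
    -- (gen 2) the broken cycle `Z₀ = W₀ ∪ ⋃ j, X₀ ∩ V(h, q j)` as ONE closed subscheme of `X₀`
    (Z₀ : Scheme) (iZ : Z₀ ⟶ (fiberOver f (AlgPoints.map π v₀)).left) (_ : IsClosedImmersion iZ)
    (_ : iZ.ker = i₀.ker ⊓ ⨅ j : Fin J,
          (pullback.snd (completeIntersectionι ![h, q j]).left (fiberι f (AlgPoints.map π v₀) ≫ e).left).ker)
    (_ : Set.range iZ.base = Set.range i₀.base ∪
          {x | (fiberι f (AlgPoints.map π v₀) ≫ e).left.base x ∈ projZero N {h} ∧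
            ∃ j : Fin J, (fiberι f (AlgPoints.map π v₀) ≫ e).left.base x ∈ projZero N {q j}})
    -- (gen 2, Bloch's shape) the flat family on the base change, central fibre ≅ Z₀ compatibly
    (𝒲 : Scheme) (ι : 𝒲 ⟶ (familyPullback f π).left) (_ : IsClosedImmersion ι)
    (_ : Flat (ι ≫ (familyPullback.snd f π).left))
    (ε : pullback ι (fiberι (familyPullback.snd f π) v₀).left ≅ Z₀),
    pullback.fst ι (fiberι (familyPullback.snd f π) v₀).left ≫ ι ≫ (familyPullback.fst f π).left =
      ε.hom ≫ iZ ≫ (fiberι f (AlgPoints.map π v₀)).left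

/-! ## §2 The five statements -/

/-- Statement of STUB S1 — **THE LEVER: POLAR ANCHORED LIFTING** (hardest; representative + polar
patch + `C⁺` + Bloch, packaged as their deformation-theoretic OUTPUT). For every smooth projective
family of FOURFOLDS `f : 𝒳 ⟶ S` with quasi-projective total space over a smooth irreducible affine
base, every global class `A ∈ H⁴(𝒳(ℂ); ℂ)` fibrewise rational of type `(2,2)`, and every anchor `s₀`
with `A|_{𝒳_{s₀}}` algebraic: there are a SMOOTH `π : V ⟶ S` and `v₀ ∈ V(ℂ)` over `s₀` such that the
pulled-back class on `𝒳 ×_S V ⟶ V` has a POLAR FAMILY at `v₀` (`HasPolarFamily`).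
INTENDED PROOF (card + TRIAGE r1-1/2/3): (i) REPRESENTATIVE — `A|_{s₀}` rational algebraic ⇒
`m·A|_{s₀} = Σ nᵢ[Vᵢ]`; link negative and repeated terms away inside complete intersections and
smooth / make lci (Kleiman 1969: `dim V = 2 < (4+2)/2`, char 0; liaison preserves ACM-ness, so to
enter the regime `R` the irreducible lci representative `W₀` must be chosen irregular / non-ACM) with
`[W₀] ≡ m·A|_{s₀}` modulo `φ^*H⁴(ℙᴺ)`; (ii) POLAR PATCH — `h` general of degree `k ≫ 0`,
`B = W₀ ∩ V(h)`, patches through `B`: primary `q ⊇ W₀` of minimal degree `d₀` (then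
`N_W|_{W₀} = ` elementary modification along `ℓ = N_{W₀/G}`, `H¹(N_W|_{W₀}) ≅ H¹(W₀, 𝓘_Σ(d₀))` for
`k ≫ 0`, absorbed subspace `im(H¹(ℓ) → H¹(N_{W₀})) = H¹(W₀, K_X(d₀)|_{W₀})^∨`-dual — ZERO outside the
regime `R`, triage (R)), or several `q_j ⊇ B` with prescribed tangent planes along `B`
(`N_W|_{W₀} = N_{W₀}(B)`, all of `H¹(N_{W₀})` absorbed, forced nodes `δ_j = deg ℓ_j^⊥(k_j)|_B` on
`C_j` — the Thomas-type hazard, line card §First computations); (iii) `C⁺` — Bloch's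
`π_W : H¹(W, N_W) → H³(X₀, Ω¹)` injective for `k ≥ k₀` (interface cokernel
`coker(H⁰(N_W|_{W₀}) ⊕ H⁰(N_W|_C) → H⁰(B, N_W|_B))` and patch term `H¹(N_W|_C) ≈ H^{0,2}(X₀)² ⊕
H¹(𝒪_{X₀}(d₀))` are `O(1)` in `k`); (iv) BLOCH — `[W] = λ⁻¹(m·A − U)|_{s₀} + [C]` stays Hodge on all of
`S`, so the Hilbert scheme `Hilb(𝒳/S)` is smooth over `S` at `[W]`; an étale (hence smooth)
neighbourhood `V → S` of `s₀` carries a section: the flat `𝒲`. WHY IT MIGHT FAIL: the interface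
cokernel may meet `ker π_W` (card falsifier (a): functoriality of the BF map under `𝒪_W → 𝒪_{W₀}`);
outside `R` only the nodal variant is live and its hazard is uncomputed; the representative step must
produce an IRREDUCIBLE lci `W₀` (unions meeting in points are not lci). NOT implied by
`HodgeConjecture` (HC gives some dominant Hilbert component, not one through a polar-patched
irreducible-lci point), not refuted by any landed Negative lemma, not a costume.
[Bloch 1972 Invent. Math. 17; BuchweitzFlenner2003 Thm 5.2, Def 4.10, Prop 8.2; Thomas
arXiv:math/0212216 §5; Voisin Torino L3 §0 (green1994 p.150); Kleiman, Publ. IHÉS 36 (1969) §5;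
Peskine–Szpiro 1974; Hartshorne–Hirschowitz 1985; Duque–Villaflor arXiv:2112.14818 Thm 1.1/5.4] -/
def PolarAnchoredLifting : Prop :=
  ∀ ⦃𝒳 S : SchemeOver ℂ⦄ (f : 𝒳 ⟶ S), IsSmoothProjectiveFamily f 4 → IsQuasiProjectiveOver 𝒳 →
    IrreducibleSpace S.left → IsAffine S.left → AlgebraicGeometry.Smooth S.hom →
    ∀ (A : complexBetti 𝒳 (2 * 2)),
    (∀ s : ComplexPoints S, IsRationalClass (complexBetti.map (fiberι f s) (2 * 2) A) ∧
      IsOfHodgeType 4 (fiberOver f s) (2 * 2) 2 2 (complexBetti.map (fiberι f s) (2 * 2) A)) →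
    ∀ (s₀ : ComplexPoints S),
      complexBetti.map (fiberι f s₀) (2 * 2) A ∈ algebraicClasses (fiberOver f s₀) 2 →
    -- (gen 3) the anchor class is NOT AMBIENT: no non-zero rational multiple is a class pulled back from `ℙᴺ`
    (∀ (N : ℕ) (e : 𝒳 ⟶ projectiveSpace N ℂ) (u : complexBetti (projectiveSpace N ℂ) (2 * 2)) (m : ℚ),
      m ≠ 0 → (m : ℂ) • complexBetti.map (fiberι f s₀) (2 * 2) A -
        complexBetti.map (fiberι f s₀ ≫ e) (2 * 2) u ≠ 0) →
    ∃ (V : SchemeOver ℂ) (π : V ⟶ S) (_ : AlgebraicGeometry.Smooth π.left) (v₀ : ComplexPoints V)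
      (_ : AlgPoints.map π v₀ = s₀), HasPolarFamily f A π v₀

/-- Statement of STUB S1b — **the lever granted Bloch's theorem** (lead's reshape gen 2; THE BET; see the
registered form `stub_polarLiftOfBloch` for the content). -/
def PolarLiftOfBloch : Prop :=
  Bloch1972_semiregularSubschemeLifts → PolarAnchoredLifting

/-- Statement of STUB S2 — **THE ENGINE, geometric half: POLAR FAMILIES CARRY THE CLASS** (classical;
lead's reshape gen 2: consumes Bloch's output shape and concludes in the input shape of the landed S3).
For a smooth projective family of fourfolds `f : 𝒳 ⟶ S` with quasi-projective total space over a smooth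
irreducible affine base, ANY global class `A ∈ H⁴(𝒳(ℂ); ℂ)`, a smooth `π : V ⟶ S` and `v₀ ∈ V(ℂ)`: a
polar family for `A` at `(π, v₀)` makes `A|_{𝒳_{π t'}}` algebraic for every complex point `t'` of `V` over
some Zariski open `U ∋ v₀`. Proof in print: `m·A|_{X₀} − φ^*u ∈ H⁴_{W₀}(X₀(ℂ)) = ℂ·[W₀]` (`W₀` irreducible,
Fulton §19.1), say `= λ[W₀]`; the classes `[𝒲_{t'}]` of the fibres of the FLAT family `𝒲 → V` are the
restrictions of one global class `cl(𝒲)` on `𝒳 ×_S V` (Fulton Ch. 10 + §19.2; Voisin II §9.2) with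
`[𝒲_{v₀}] = [W₀] + Σ_j μ_j[C_j]`, `[C_j]` ambient; global classes restrict rigidly over the irreducible
smooth `V` near `v₀`; hence `(m·A − e^*u)|_{𝒳_{π t'}} = λ([𝒲_{t'}] − ambient)` is algebraic, and so is
`A|` (`m ≠ 0`; `e^*u` by the moving lemma; `λ = 0`: `m·A − e^*u` vanishes at `v₀` hence nearby). Split
(gen 2) at the classical input: S2 ⟸ S2a (`FlatFamilyCycleClass`, named fact) + S2b (the rest, provable
now). [Fulton 1998 §10.1, §19.1–19.2; Voisin II Prop 9.21; BuchweitzFlenner2003 §5] -/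
def FlatFamilyCarriesClass : Prop :=
  ∀ ⦃𝒳 S : SchemeOver ℂ⦄ (f : 𝒳 ⟶ S), IsSmoothProjectiveFamily f 4 → IsQuasiProjectiveOver 𝒳 →
    IrreducibleSpace S.left → IsAffine S.left → AlgebraicGeometry.Smooth S.hom →
    ∀ (A : complexBetti 𝒳 (2 * 2)) (V : SchemeOver ℂ) (π : V ⟶ S), AlgebraicGeometry.Smooth π.left →
    ∀ (v₀ : ComplexPoints V), HasPolarFamily f A π v₀ →
    ∃ U : Set V.left, IsOpen U ∧ v₀.pt ∈ U ∧
      ∀ t' : ComplexPoints V, t'.pt ∈ U →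
        complexBetti.map (fiberι f (AlgPoints.map π t')) (2 * 2) A ∈
          algebraicClasses (fiberOver f (AlgPoints.map π t')) 2

/-- Statement of STUB S2a — **specialisation of the cycle class of a flat family, with a non-zero
coefficient on a component of the expected codimension** (Fulton 1998 Ch. 10 + §19; lead's reshape gen 2;
see `stub_flatFamilyCycleClass`). [Fulton 1998, Cor. 10.1, Prop. 10.2, Cor. 19.2 (b), Lemma 19.1.1] -/
def FlatFamilyCycleClass : Prop :=
  ∀ ⦃n p : ℕ⦄ ⦃𝒳 V : SchemeOver ℂ⦄ (g : 𝒳 ⟶ V), IsSmoothProjectiveFamily g n →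
    AlgebraicGeometry.Smooth V.hom →
    ∀ (𝒲 : Scheme) (ι : 𝒲 ⟶ 𝒳.left), IsClosedImmersion ι → Flat (ι ≫ g.left) →
    ∀ (v₀ : ComplexPoints V) (W₀ C : Set (fiberOver g v₀).left),
    IsClosed W₀ → IsIrreducible W₀ → IsClosed C →
    Set.range (pullback.snd ι (fiberι g v₀).left).base = W₀ ∪ C → ¬ (W₀ ⊆ C) →
    (∀ z ∈ W₀ ∪ C, (p : ℕ∞) ≤ Order.coheight z) → (∃ z ∈ W₀, Order.coheight z = p) →
    ∃ (Γ : complexBetti 𝒳 (2 * p)) (w : complexBetti (fiberOver g v₀) (2 * p)) (c₀ : ℂ),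
      (∀ t : ComplexPoints V,
        complexBetti.map (fiberι g t) (2 * p) Γ ∈ algebraicClasses (fiberOver g t) p) ∧
      w ∈ classesSupportedOn (fiberOver g v₀) W₀ (2 * p) ∧ w ≠ 0 ∧ c₀ ≠ 0 ∧
      complexBetti.map (fiberι g v₀) (2 * p) Γ - c₀ • w ∈ classesSupportedOn (fiberOver g v₀) C (2 * p)

/-- Statement of STUB S2b — **polar families carry the class, granted the flat-family cycle class**
(lead's reshape gen 2; provable now, see `stub_carriesClassOfCycleClass`). -/
def CarriesClassOfCycleClass : Prop :=
  FlatFamilyCycleClass → FlatFamilyCarriesClass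

/-- Statement of STUB S3 — **THE ENGINE, closing half: DOMINANCE ALONG A SMOOTH BASE CHANGE**
(PROVABLE NOW, size S–M). For a smooth projective family `f : 𝒳 ⟶ S` (any relative dimension `n`,
any degree `p`) with quasi-projective total space over a smooth irreducible affine base, a SMOOTH
`π : V ⟶ S` and a non-empty Zariski open `U ⊆ V`: if `A|_{𝒳_{π t'}}` is algebraic for every
`t' ∈ V(ℂ)` over `U`, then `A|_{𝒳_t}` is algebraic for EVERY `t ∈ S(ℂ)`. Proof for the prover: the
image of `U` under the smooth (flat, locally of finite presentation) `π` is open in `S` (Mathlib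
`UniversallyOpen` / Chevalley) and non-empty, and every complex point of `S` over it is the image of a
complex point of `U` (its fibre is a non-empty smooth `ℂ`-scheme of finite type, which has a rational
point); then `Theorems.variationalHodge_dominance_of_open` (modulo
`charlesSchnell_algebraicityLocus_iUnion_closed`, `mumford_smoothCurve_through_two_points`;
projectivity of `f` from `Theorems.exists_isClosedImmersion_of_isSmoothProjectiveFamily`).
[CharlesSchnell2014Notes Prop 11.3.11 (proof); MumfordAV1970 §6 Lemma; EGA IV 2.4.6] -/
def DominanceAlongSmooth : Prop :=
  ∀ ⦃n : ℕ⦄ ⦃𝒳 S : SchemeOver ℂ⦄ (f : 𝒳 ⟶ S), IsSmoothProjectiveFamily f n → IsQuasiProjectiveOver 𝒳 →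
    IrreducibleSpace S.left → IsAffine S.left → AlgebraicGeometry.Smooth S.hom →
    ∀ (p : ℕ) (A : complexBetti 𝒳 (2 * p)) (V : SchemeOver ℂ) (π : V ⟶ S),
    AlgebraicGeometry.Smooth π.left →
    ∀ (U : Set V.left), IsOpen U → U.Nonempty →
    (∀ t' : ComplexPoints V, t'.pt ∈ U →
      complexBetti.map (fiberι f (AlgPoints.map π t')) (2 * p) A ∈
        algebraicClasses (fiberOver f (AlgPoints.map π t')) p) →
    ∀ t : ComplexPoints S,
      complexBetti.map (fiberι f t) (2 * p) A ∈ algebraicClasses (fiberOver f t) p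

/-- Statement of STUB S4 — **THOMAS'S HYPERPLANE DESCENT OF `V₂` TO RELATIVE DIMENSION FOUR**
(classical, size L–XL; the line's frame, not its bet; lead's reshape cycle 1: `n ≥ 5` ONLY — the
cases `n ≤ 3` are free, `vhcTwoAffine_of_le_three`, and `n = 4` is the line). If `V₂` holds over
affine bases for families of FOURFOLDS with quasi-projective total space, it holds in every relative
dimension `n ≥ 5`: Thomas's descent `VHC(n,2) ⇐ VHC(n−1,2)` for `2p = 4 < n` — restrict `A` to the
universal smooth hyperplane-section family `𝒴 → S × U` (quasi-projective total space, smooth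
irreducible base; back to affine opens by the landed `Q`-stable chain), where the anchor restricts to
an anchor, conclude on every `X_s ∩ H`, and sweep: `m·c = q_*(𝒲·ζ^{N−1}) − Σ_{j≥1} w_j s_j(E)` on the
projective bundle of hyperplanes through points of `X_s`, `w_j` algebraic of lower codimension by
triangularity (weak Lefschetz: `H⁴(X_s) ↪ H⁴(X_s ∩ H)`); induct down to `n = 4`. WHY IT MIGHT FAIL:
the sweep needs the cycles on `X_s ∩ H` chosen algebraically in `H` (relative Hilbert scheme over a
finite cover of an open of the dual space) and a push-forward (Gysin) of classes on real carriers,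
which the tree has only as the hypothesis structure `GysinFormalism`. [Thomas arXiv:math/0212216 §5
("presumably standard" reductions to `(2p,p)`, `(2p−1,p)`); Voisin II §1.2; card NOTES F2] -/
def ReductionToFourfoldsTwo : Prop :=
  VHCTwoAffine 4 → ∀ n : ℕ, 5 ≤ n → VHCTwoAffine n

/-- Statement of STUB S4a — **the pencil SWEEP** (lead's split of S4, cycle 1; PROVED by the S4 worker,
see the registered form `stub_pencilSweep` below and `Theorems/AnchorTransportVariationalHodgePencilSweep.lean`). -/
def PencilSweep : Prop :=
  ∀ {m N : ℕ} {X : SchemeOver ℂ}, IsSmoothProjective (m + 1) X →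
    ∀ (ι : X ⟶ projectiveSpace N ℂ) [IsClosedImmersion ι.left]
    {a : Fin (1 + 1) → Fin (N + 1) → ℂ}, a ≠ 0 →
    IsSmoothProjective (m + 1) (LinearSectionNet.total ι a) →
    ∀ {T : Set (projectiveSpace 1 ℂ).left}, IsClosed T → T ≠ Set.univ →
    (∀ s : ComplexPoints (projectiveSpace 1 ℂ), s.pt ∉ T →
      IsSmoothProjective m (fiberOver (LinearSectionNet.proj ι a) s)) →
    ∀ {q : ℕ}, 2 * (q + 1) ≤ m →
    (∀ c' : complexBetti X (2 * q), IsRationalClass c' → IsOfHodgeType (m + 1) X (2 * q) q q c' →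
      c' ∈ algebraicClasses X q) →
    ∀ (c : complexBetti X (2 * (q + 1))),
    (∀ s : ComplexPoints (projectiveSpace 1 ℂ), s.pt ∉ T →
      complexBetti.map (fiberι (LinearSectionNet.proj ι a) s) (2 * (q + 1))
        (complexBetti.map (LinearSectionNet.blowDown ι a) (2 * (q + 1)) c) ∈
        algebraicClasses (fiberOver (LinearSectionNet.proj ι a) s) (q + 1)) →
    c ∈ algebraicClasses X (q + 1)

/-- Statement of STUB S4h — **the `H`-direction of Thomas's descent** (lead c1-0's split of S4b, gen 4; LANDED
as `Theorems.stub_hDirection`, p139049): for a pencil `(ι, a)` of a smooth projective `(m+1)`-fold `X` with smooth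
projective total space, smooth of relative dimension `m` over an open `V ⊆ ℙ¹` all of whose members are smooth
projective `m`-folds, a rational `(2,2)` class `c` on `X` and `V₂(m)` over affine bases: if `ι_t^* σ^* c` is algebraic
on ONE member over `V`, it is algebraic on EVERY member over `V`. [Thomas arXiv:math/0212216 §2, §5] -/
def HDirection : Prop :=
  ∀ {m N : ℕ} {X : SchemeOver ℂ}, IsSmoothProjective (m + 1) X → VHCTwoAffine m →
    ∀ (ι : X ⟶ projectiveSpace N ℂ) [IsClosedImmersion ι.left]
      (a : Fin (1 + 1) → Fin (N + 1) → ℂ), IsSmoothProjective (m + 1) (LinearSectionNet.total ι a) →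
    ∀ (V : (projectiveSpace 1 ℂ).left.Opens),
      SmoothOfRelativeDimension m ((LinearSectionNet.proj ι a).left ∣_ V) →
      (∀ t : ComplexPoints (projectiveSpace 1 ℂ), t.pt ∈ V →
        IsSmoothProjective m (fiberOver (LinearSectionNet.proj ι a) t)) →
    ∀ (c : complexBetti X (2 * 2)), IsRationalClass c → IsOfHodgeType (m + 1) X (2 * 2) 2 2 c →
    ∀ {t₁ : ComplexPoints (projectiveSpace 1 ℂ)}, t₁.pt ∈ V →
      complexBetti.map (fiberι (LinearSectionNet.proj ι a) t₁) (2 * 2)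
          (complexBetti.map (LinearSectionNet.blowDown ι a) (2 * 2) c) ∈
        algebraicClasses (fiberOver (LinearSectionNet.proj ι a) t₁) 2 →
    ∀ (t : ComplexPoints (projectiveSpace 1 ℂ)), t.pt ∈ V →
      complexBetti.map (fiberι (LinearSectionNet.proj ι a) t) (2 * 2)
          (complexBetti.map (LinearSectionNet.blowDown ι a) (2 * 2) c) ∈
        algebraicClasses (fiberOver (LinearSectionNet.proj ι a) t) 2

/-- Statement of STUB S4b — **Thomas's descent given the sweep and the `H`-direction** (lead c1-0's split of S4,
gen 4): the remaining `s`-direction (relative hyperplane sections of the family through `s` and the anchor) + the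
generic choices (one hyperplane regular for both `X_s` and `X_{s₀}` keeping the anchor algebraic; a good pencil of `X_s`
through it), see `stub_thomasDescentOfSweep`. -/
def ThomasDescentOfSweep : Prop :=
  PencilSweep → HDirection → ReductionToFourfoldsTwo

/-- Statement of STUB S5 — **THE RESIDUAL OFF THE POLAR SCOPE (NOT A LEMMA OF THIS LINE).** The crux
verbatim in the MIDDLE RANGE of codimensions `2 ≤ p ≤ n - 2` for every datum OUTSIDE the scope
`p = 2 ∧ IsQuasiProjectiveOver 𝒳` (lead's reshape cycle 1: the former clauses `p = 1` — Lefschetz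
`(1,1)` — and `p ≥ n - 1` — hard Lefschetz + Lefschetz `(1,1)` — are now theorems of the tree,
`Theorems.variationalHodge_conclusion_of_lefschetzRange` with `lefschetzOneOne_rational_holds` and
`nonempty_hardLefschetzNFold_holds`, and left the stub). What remains: (b) `3 ≤ p ≤ n − 2` — the OPEN
remainder of Grothendieck's conjecture, beyond this line: the card's "General p" would patch
codimension-`p` cycles in `2p`-folds (the only clean numerology) with Bloch's
`π_W : H¹(N_W) → H^{p+1}(Ω^{p−1})` (now in tree for lci subschemes: `IsBlochSemiregular`,
`Bloch1972_semiregularSubschemeLifts`), but without the finiteness of the forced singular locus that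
`n = 2p = 4` enjoys; (c) `p = 2` with NON-quasi-projective total space — the crux's modelling residue
(Atiyah-flop families; `Theorems.variationalHodge_of_projective_of_isQuasiProjectiveOver` isolates it;
prover verdict-misstated 2026-08-16 ×2). `HodgeConjecture`-implied like the crux
(`Disproof.hodgeConjecture_imp`), hence irrefutable short of `¬ HC`, and crux-sized; carried only so
that the composition concludes the crux BY NAME; NOT delegated to a worker. RECOMMENDATION (planner
gen 1, prover seats -2/0, this lead): `route edit --split VariationalHodge` by codimension with the
quasi-projectivity repair, after which this stub leaves the skeleton.
[CharlesSchnell2014Notes Conj 11.3.1, Cor 11.3.6] -/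
def ResidualOffPolarScope : Prop :=
  ∀ ⦃n : ℕ⦄ ⦃𝒳 S : SchemeOver ℂ⦄ (f : 𝒳 ⟶ S), IsSmoothProjectiveFamily f n →
    IrreducibleSpace S.left → IsAffine S.left → AlgebraicGeometry.Smooth S.hom →
    topologicalKrullDim S.left = 1 →
    ∀ (p : ℕ), 2 ≤ p → p + 2 ≤ n → ¬ InPolarScope p 𝒳 →
    ∀ (A : complexBetti 𝒳 (2 * p)),
    (∀ s : ComplexPoints S, IsRationalClass (complexBetti.map (fiberι f s) (2 * p) A) ∧
      IsOfHodgeType n (fiberOver f s) (2 * p) p p (complexBetti.map (fiberι f s) (2 * p) A)) →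
    (∃ s₀ : ComplexPoints S,
      complexBetti.map (fiberι f s₀) (2 * p) A ∈ algebraicClasses (fiberOver f s₀) p) →
    ∀ s : ComplexPoints S,
      complexBetti.map (fiberι f s) (2 * p) A ∈ algebraicClasses (fiberOver f s) p

/-- Statement of STUB C₂ (generation 7, lead c3-0) — **the strategist's CODIM-SPLIT child `VariationalHodgeTwoProper`,
VERBATIM** (`Cruxes/VariationalHodge/AnchorTransportVariationalHodgeCodimSplit.lean`, hypothesis `h₂` of
`variationalHodge_of_codimSplit`; `CODIM-SPLIT.md`, children.json rank 4): the crux in codimension `p = 2`, relative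
dimension `n ≥ 4`, for smooth proper families with projective fibres whose total space is NOT quasi-projective (the
quasi-projectivity clause inlined as in the strategist's file; `Iff.rfl` with `¬ IsQuasiProjectiveOver 𝒳`), over smooth
irreducible affine CURVE bases. The decl's modelling residue (Atiyah-flop / mixed small resolution families are proper,
fibrewise projective, not projective near the special point; prover verdict-misstated 2026-08-16 ×2;
`Theorems.AnchorTransportVariationalHodgeQuasiProjective`). `HodgeConjecture`-implied like the crux; crux-sized; NOT a lemma of
this line and NOT delegated — carried so that `VariationalHodge_of` concludes the crux BY NAME; to be PROMOTED (route split).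
[cite: CharlesSchnell2014Notes, Conj. 11.3.1, Cor. 11.3.6] -/
def VariationalHodgeTwoProper : Prop :=
  ∀ ⦃n : ℕ⦄ ⦃𝒳 S : SchemeOver ℂ⦄ (f : 𝒳 ⟶ S), IsSmoothProjectiveFamily f n →
    ¬ (∃ (P : SchemeOver ℂ) (j : 𝒳 ⟶ P), IsProjectiveOver P ∧ IsOpenImmersion j.left) →
    IrreducibleSpace S.left → IsAffine S.left → AlgebraicGeometry.Smooth S.hom →
    topologicalKrullDim S.left = 1 → 4 ≤ n →
    ∀ (A : complexBetti 𝒳 (2 * 2)),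
    (∀ s : ComplexPoints S, IsRationalClass (complexBetti.map (fiberι f s) (2 * 2) A) ∧
      IsOfHodgeType n (fiberOver f s) (2 * 2) 2 2 (complexBetti.map (fiberι f s) (2 * 2) A)) →
    (∃ s₀ : ComplexPoints S,
      complexBetti.map (fiberι f s₀) (2 * 2) A ∈ algebraicClasses (fiberOver f s₀) 2) →
    ∀ s : ComplexPoints S,
      complexBetti.map (fiberι f s) (2 * 2) A ∈ algebraicClasses (fiberOver f s) 2

/-- Statement of STUB C₃ (generation 7, lead c3-0) — **the strategist's CODIM-SPLIT child `VariationalHodgeHigherCodim`,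
VERBATIM** (hypothesis `h₃` of `variationalHodge_of_codimSplit`; children.json rank 3): the crux in codimensions
`3 ≤ p ≤ n - 2` over smooth irreducible affine CURVE bases (any total space) — the OPEN remainder of Grothendieck's conjecture
beyond the surfaces-in-fourfolds numerology of this line (only engine on record: standard conjecture `B` + André 1996 Thm 0.5,
line `codim-split-motivic`). `HodgeConjecture`-implied; crux-sized; NOT delegated; to be PROMOTED.
[cite: CharlesSchnell2014Notes, Conj. 11.3.1, Cor. 11.3.6] -/
def VariationalHodgeHigherCodim : Prop :=
  ∀ ⦃n : ℕ⦄ ⦃𝒳 S : SchemeOver ℂ⦄ (f : 𝒳 ⟶ S), IsSmoothProjectiveFamily f n →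
    IrreducibleSpace S.left → IsAffine S.left → AlgebraicGeometry.Smooth S.hom →
    topologicalKrullDim S.left = 1 →
    ∀ (p : ℕ), 3 ≤ p → p + 2 ≤ n →
    ∀ (A : complexBetti 𝒳 (2 * p)),
    (∀ s : ComplexPoints S, IsRationalClass (complexBetti.map (fiberι f s) (2 * p) A) ∧
      IsOfHodgeType n (fiberOver f s) (2 * p) p p (complexBetti.map (fiberι f s) (2 * p) A)) →
    (∃ s₀ : ComplexPoints S,
      complexBetti.map (fiberι f s₀) (2 * p) A ∈ algebraicClasses (fiberOver f s₀) p) →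
    ∀ s : ComplexPoints S,
      complexBetti.map (fiberι f s) (2 * p) A ∈ algebraicClasses (fiberOver f s) p

/-- **The residual is the conjunction of the two children** (generation 7 glue, PROVED): off the scope
`p = 2 ∧ IsQuasiProjectiveOver 𝒳` in the middle range, either `p = 2` — then the total space is not quasi-projective
(`IsQuasiProjectiveOver` is the inlined `∃ P j, …` by `Iff.rfl`) and `n ≥ p + 2 = 4`: child C₂ — or `3 ≤ p`: child C₃. [folklore] -/
theorem residualOffPolarScope_of_children (h₂ : VariationalHodgeTwoProper) (h₃ : VariationalHodgeHigherCodim) :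
    ResidualOffPolarScope := by
  intro n 𝒳 S f hf hirr haff hsm hdim p hp2 hpn hscope A hA hs₀ s
  rcases Nat.eq_or_lt_of_le hp2 with rfl | hp3
  · have hqp : ¬ (∃ (P : SchemeOver ℂ) (j : 𝒳 ⟶ P), IsProjectiveOver P ∧ IsOpenImmersion j.left) :=
      fun h => hscope ⟨rfl, h⟩
    exact h₂ f hf hqp hirr haff hsm hdim (by omega) A hA hs₀ s
  · exact h₃ f hf hirr haff hsm hdim p (by omega) hpn A hA hs₀ s

/-- **Conversely the residual gives both children** (so the generation-7 cut is LOSSLESS): C₂ is the residual at `p = 2`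
(off scope because the total space is not quasi-projective), C₃ the residual at `p ≥ 3` (off scope because `p ≠ 2`). [folklore] -/
theorem residualOffPolarScope_iff_children :
    ResidualOffPolarScope ↔ (VariationalHodgeTwoProper ∧ VariationalHodgeHigherCodim) := by
  refine ⟨fun hR => ⟨?_, ?_⟩, fun h => residualOffPolarScope_of_children h.1 h.2⟩
  · intro n 𝒳 S f hf hqp hirr haff hsm hdim hn A hA hs₀ s
    exact hR f hf hirr haff hsm hdim 2 le_rfl (by omega) (fun h => hqp h.2) A hA hs₀ s
  · intro n 𝒳 S f hf hirr haff hsm hdim p hp3 hpn A hA hs₀ s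
    exact hR f hf hirr haff hsm hdim p (by omega) hpn (fun h => by obtain ⟨h1, -⟩ := h; omega) A hA hs₀ s

/-! ## §2b Generation 3 (lead, cycle 1): THE BET AS AN ABSOLUTE STATEMENT ON ONE FOURFOLD

`SemiregularBrokenRepresentative` is the card's lever `C⁺` + representative + polar patch, stated for ONE
smooth projective fourfold `X₀ ⊆ ℙᴺ` and ONE rational `(2,2)` ALGEBRAIC class `a` — no family, no base.
`polarLiftOfBloch_of_absolute` PROVES that it implies the registered bet `PolarLiftOfBloch`
(`= Bloch1972_semiregularSubschemeLifts → PolarAnchoredLifting`): the family-side inputs of Bloch's fact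
(`SupportClassStaysHodge` of every component, from the fibrewise `(2,2)` global class `μ·A + e^*u'`;
the Hartshorne-projective embedding, from quasi-projectivity) are glue, not bet. -/

/-- **THE BET, absolute form (generation 3).** For every smooth projective fourfold `X₀` with a closed
immersion `φ : X₀ ↪ ℙᴺ` and every rational `(2,2)` class `a` which is ALGEBRAIC: there are polar data
(`W₀` integral lci surface, `m ≠ 0`, `u` with `m·a − φ^*u` supported on `W₀`; forms `h`, `q_j` with the
incidences; patch classes ambient) and the broken cycle `Z₀ = W₀ ∪ ⋃ C_j` as one lci closed subscheme
(ideal `𝓘_{W₀} ⊓ ⨅ 𝓘_{C_j}`, the stated set, pure of codimension `2`) which is BLOCH-SEMIREGULAR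
(`IsBlochSemiregular iZ 4 2`), each of whose components carries a NON-ZERO class of the form
`μ·a + φ^*u'` (for `W₀`: `m·a − φ^*u` when it is non-zero, an ambient class otherwise; for the patches:
ambient classes). Research-open; not implied by `HodgeConjecture`. LCI RESTRICTION (lead c1-0's addendum,
S1-analysis-c1.md §7): `Z₀` lci forces ONE patch per interface curve, attached inside one `G = X₀ ∩ V(q) ⊇ W₀`
(`𝓘_{W₀} ∩ 𝓘_C = (q, w·h)` locally; two patches through `B` give `(xy, xz, yz)`, not lci), so within Bloch's lci theorem the
bet is live only in TRIAGE's regime (R) `H¹(W₀, K_{X₀}(d₀)|_{W₀}) ≠ 0` with `J = 1`; the statement (`∃ J`) is unchanged.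
THE PATCH IS `k`-FREE (lead c2-0, cycle 2, `Lines/polar-patch-broken-cycles-S1b-analysis-c2.md`, Theorem N / Prop. S): for
`W = W₀ ∪ (G ∩ V(h))` every `ξ ∈ K_G ∩ ker π_{W₀} ∖ 𝔄_G` (`K_G = ker(H¹(N_{W₀}) → H¹(𝒪_{W₀}(d)))`,
`𝔄_G = im H¹(N_{W₀/G})`) gives a non-zero element of `ker π_W` for EVERY degree `k` of `h`, and for `k ≫ 0` on hypersurface
fourfolds `H¹(W, N_W) ≅ K_G/𝔄_G` (on CY fourfolds `= K_G/K_G^⊥`, `π = ob^∨`, Bae–Kool–Park 2208.09474 Prop 1.9); so "asymptotic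
polar semiregularity" is not a principle, and the bet's honest content is the EXISTENCE of G-relatively semiregular representatives
(`K_G ⊆ ob_{W₀/X}(H¹(T_X)) + K_G^⊥` on CY4) — sandwiched between Bloch's open Rem. (7.5) (which implies it:
`semiregularBrokenRepresentative_of_semiregularRepresentative`, §2c, landed as
`Theorems.semiregularBrokenRepresentative_of_semiregularRepresentative` p141813) and its G-relative weakening. -/
def SemiregularBrokenRepresentative : Prop :=
  ∀ ⦃X₀ : SchemeOver ℂ⦄, IsSmoothProjective 4 X₀ →
    ∀ ⦃N : ℕ⦄ (φ : X₀ ⟶ projectiveSpace N ℂ), IsClosedImmersion φ.left →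
    ∀ (a : complexBetti X₀ (2 * 2)), IsRationalClass a → IsOfHodgeType 4 X₀ (2 * 2) 2 2 a →
      a ∈ algebraicClasses X₀ 2 →
    (∀ (u : complexBetti (projectiveSpace N ℂ) (2 * 2)) (m : ℚ), m ≠ 0 →
      (m : ℂ) • a - complexBetti.map φ (2 * 2) u ≠ 0) →
    ∃ (W₀ : Scheme) (i₀ : W₀ ⟶ X₀.left) (_ : IsClosedImmersion i₀) (_ : IsIntegral W₀)
      (_ : IsFiniteLocallyFree (conormalSheaf i₀))
      (_ : ∀ w : W₀, (2 : ℕ∞) ≤ Order.coheight (i₀.base w))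
      (_ : ∃ w : W₀, Order.coheight (i₀.base w) = 2)
      (m : ℚ) (_ : m ≠ 0) (u : complexBetti (projectiveSpace N ℂ) (2 * 2))
      (_ : (m : ℂ) • a - complexBetti.map φ (2 * 2) u ∈ classesSupportedOn X₀ (Set.range i₀.base) (2 * 2))
      (J k : ℕ) (d : Fin J → ℕ) (h : MvPolynomial (Fin (N + 1)) ℂ) (q : Fin J → MvPolynomial (Fin (N + 1)) ℂ)
      (_ : 0 < k) (_ : ∀ j, 0 < d j) (_ : h.IsHomogeneous k) (_ : ∀ j, (q j).IsHomogeneous (d j))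
      (_ : ∃ w : W₀, φ.left.base (i₀.base w) ∉ projZero N {h})
      (_ : ∀ (j : Fin J) (w : W₀), φ.left.base (i₀.base w) ∈ projZero N {h} →
            φ.left.base (i₀.base w) ∈ projZero N {q j})
      (_ : ∀ j : Fin J, IsIrreducible (φ.left.base ⁻¹' (projZero N {h} ∩ projZero N {q j})))
      (_ : ∀ (j : Fin J) (x : X₀.left),
            φ.left.base x ∈ projZero N {h} ∩ projZero N {q j} → (2 : ℕ∞) ≤ Order.coheight x)
      (_ : classesSupportedOn X₀
            {x | φ.left.base x ∈ projZero N {h} ∧ ∃ j : Fin J, φ.left.base x ∈ projZero N {q j}} (2 * 2) ≤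
          LinearMap.range (complexBetti.map φ (2 * 2)).hom)
      (Z₀ : Scheme) (iZ : Z₀ ⟶ X₀.left) (_ : IsClosedImmersion iZ)
      (_ : IsFiniteLocallyFree (conormalSheaf iZ))
      (_ : iZ.ker = i₀.ker ⊓ ⨅ j : Fin J, (pullback.snd (completeIntersectionι ![h, q j]).left φ.left).ker)
      (_ : Set.range iZ.base = Set.range i₀.base ∪
            {x | φ.left.base x ∈ projZero N {h} ∧ ∃ j : Fin J, φ.left.base x ∈ projZero N {q j}})
      (_ : ∀ z : Z₀, ∃ z' : Z₀, Order.coheight (iZ.base z') = (2 : ℕ∞) ∧ iZ.base z' ⤳ iZ.base z)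
      (_ : IsBlochSemiregular iZ 4 2),
      ∀ z : Z₀, Order.coheight (iZ.base z) = (2 : ℕ∞) →
        ∃ (μ : ℂ) (u' : complexBetti (projectiveSpace N ℂ) (2 * 2)),
          μ • a + complexBetti.map φ (2 * 2) u' ∈ classesSupportedOn X₀ (closure {iZ.base z}) (2 * 2) ∧
          μ • a + complexBetti.map φ (2 * 2) u' ≠ 0

/-- **The absolute bet implies the registered bet** (generation 3 glue, PROVED): the projective embedding
of the total space (`IsQuasiProjectiveOver`: open immersion into a projective scheme, whose composite to
`ℙᴺ` is a preimmersion, so that the anchor fibre embeds by a closed immersion,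
`isClosedImmersion_fiberι_comp_left`), the Hartshorne form of `f`
(`Theorems.exists_isClosedImmersion_of_isSmoothProjectiveFamily`) and the family-side Hodge input of
Bloch's fact (`SupportClassStaysHodge` of each component: the global class `μ·A + e^*u'` is of type `(2,2)`
on every fibre — `A` by hypothesis, `e^*u'` algebraic by `map_projectiveSpace_mem_algebraicClasses` hence
`(2,2)` — and restricts on `X₀` to the non-zero supported class of the bet) are supplied here; Bloch's fact
then outputs the flat family in exactly the shape of `HasPolarFamily`. -/
theorem polarLiftOfBloch_of_absolute (hAbs : SemiregularBrokenRepresentative) : PolarLiftOfBloch := by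
  intro hBloch 𝒳 S f hf hqp hirr haff hsm A hA s₀ hs₀ hna
  have hqp' := hqp
  obtain ⟨P, jP, ⟨N, κ, hκ⟩, hjP⟩ := hqp
  haveI := hκ
  haveI := hjP
  haveI := hsm
  haveI := hf.isProper
  -- the embedding `e : 𝒳 ⟶ ℙᴺ` (open immersion into a projective scheme, then its embedding)
  set e : 𝒳 ⟶ projectiveSpace N ℂ := jP ≫ κ with hedef
  haveI : IsPreimmersion e.left := by
    rw [hedef, Over.comp_left]
    infer_instance
  -- the anchor fibre and its closed embedding into `ℙᴺ`
  have hX₀ : IsSmoothProjective 4 (fiberOver f s₀) := hf.isSmoothProjective s₀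
  have hφ : IsClosedImmersion (fiberι f s₀ ≫ e).left := isClosedImmersion_fiberι_comp_left f e s₀
  -- the absolute bet at `(X₀, φ, A|_{X₀})`
  obtain ⟨W₀, i₀, hi₀, hint, hlci, hcod, hcod2, m, hm, u, hclass, J, k, d, h, q, hk, hd, hh, hq, hnot,
    hinc, hirrj, hcodj, hamb, Z₀, iZ, hiZ, hlciZ, hker, hrange, hpure, hsr, hcomp⟩ :=
    hAbs hX₀ (fiberι f s₀ ≫ e) hφ _ (hA s₀).1 (hA s₀).2 hs₀ (fun u m hm => hna N e u m hm)
  -- the Hartshorne-projective structure of `f`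
  obtain ⟨N', ε', hε', hε'f⟩ := exists_isClosedImmersion_of_isSmoothProjectiveFamily hf hqp'
  -- the family-side Hodge input: component classes stay of type `(2,2)`
  have hstay : ∀ z : Z₀, Order.coheight (iZ.base z) = (2 : ℕ∞) →
      SupportClassStaysHodge f 4 2 s₀ (closure {iZ.base z}) := by
    intro z hz
    obtain ⟨μ, u', hsupp, hne⟩ := hcomp z hz
    have hres : ∀ s : ComplexPoints S,
        complexBetti.map (fiberι f s) (2 * 2) (μ • A + complexBetti.map e (2 * 2) u') =
          μ • complexBetti.map (fiberι f s) (2 * 2) A + complexBetti.map (fiberι f s ≫ e) (2 * 2) u' := by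
      intro s
      rw [map_add, map_smul, complexBetti.map_comp (fiberι f s) e]
      rfl
    refine SupportClassStaysHodge.intro (μ • A + complexBetti.map e (2 * 2) u') (fun s => ?_) ?_ ?_
    · rw [hres s]
      exact ((hA s).2.smul μ).add (hf.isSmoothProjective s)
        (isOfHodgeType_of_mem_algebraicClasses_of_isSmoothProjective (hf.isSmoothProjective s) 2
          (map_projectiveSpace_mem_algebraicClasses (hf.isSmoothProjective s) (fiberι f s ≫ e) 2 u'))
    · rw [hres s₀]; exact hsupp
    · rw [hres s₀]; exact hne
  -- Bloch's theorem: the flat lift over a smooth (étale) base change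
  obtain ⟨V, π, hπ, v₀, hv₀, 𝒵, ι, hι, hflat, εZ, hcompat⟩ :=
    hBloch.of_smooth f 4 2 hf ⟨N', ε', hε', hε'f⟩ hsm s₀ Z₀ iZ hiZ hlciZ hpure hstay hsr
  refine ⟨V, π, hπ, v₀, hv₀, ?_⟩
  subst hv₀
  exact ⟨N, e, W₀, i₀, hi₀, hint, hlci, hcod, hcod2, m, hm, u, hclass, J, k, d, h, q, hk, hd, hh, hq, hnot,
    hinc, hirrj, hcodj, hamb, Z₀, iZ, hiZ, hker, hrange, 𝒵, ι, hι, hflat, εZ, hcompat⟩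



/-! ## §2c The bet is implied by SEMIREGULAR REPRESENTATIVES (lead c2-0, cycle 2; `J = 0`)

Bloch 1972, Remark (7.5): "The problem of constructing semi-regular representatives for algebraic cycle classes
of codimension `> 1` remains, however, wide open." `SemiregularRepresentative` is that problem for NON-AMBIENT rational
`(2,2)` algebraic classes on smooth projective fourfolds (integral lci representative, up to a non-zero rational multiple
and ambient classes). `semiregularBrokenRepresentative_of_semiregularRepresentative` PROVES that it implies the registered
bet (take no patch: `J = 0`, `Z₀ = W₀`, `h` a coordinate not vanishing at a point of `W₀`), so the bet is AT MOST as
strong as Bloch's open problem on fourfolds; the lead's analysis (`Lines/polar-patch-broken-cycles-S1b-analysis-c2.md`,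
Theorem N) shows that with a patch (`J = 1`) semiregularity of `Z₀` is the `k`-free "G-relative" semiregularity of
`W₀`, so the bet sits between the two. -/

/-- **Semiregular representatives on fourfolds** (Bloch 1972 Rem. (7.5), restricted): every non-ambient rational
`(2,2)` algebraic class `a` on a smooth projective fourfold `X₀ ⊆ ℙᴺ` has an integral lci codimension-`2`
representative `W₀` modulo ambient classes and up to `m ∈ ℚ ∖ 0` (`m·a − φ^*u` supported on `W₀`) which is
BLOCH-SEMIREGULAR. Research-open; not implied by `HodgeConjecture`. [Bloch 1972 Invent. Math. 17, Rem. (7.5);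
Voisin, Torino L3 §0 (green1994 p.150)] -/
def SemiregularRepresentative : Prop :=
  ∀ ⦃X₀ : SchemeOver ℂ⦄, IsSmoothProjective 4 X₀ →
    ∀ ⦃N : ℕ⦄ (φ : X₀ ⟶ projectiveSpace N ℂ), IsClosedImmersion φ.left →
    ∀ (a : complexBetti X₀ (2 * 2)), IsRationalClass a → IsOfHodgeType 4 X₀ (2 * 2) 2 2 a →
      a ∈ algebraicClasses X₀ 2 →
    (∀ (u : complexBetti (projectiveSpace N ℂ) (2 * 2)) (m : ℚ), m ≠ 0 →
      (m : ℂ) • a - complexBetti.map φ (2 * 2) u ≠ 0) →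
    ∃ (W₀ : Scheme) (i₀ : W₀ ⟶ X₀.left) (_ : IsClosedImmersion i₀) (_ : IsIntegral W₀)
      (_ : IsFiniteLocallyFree (conormalSheaf i₀))
      (_ : ∀ w : W₀, (2 : ℕ∞) ≤ Order.coheight (i₀.base w))
      (_ : ∃ w : W₀, Order.coheight (i₀.base w) = 2)
      (m : ℚ) (_ : m ≠ 0) (u : complexBetti (projectiveSpace N ℂ) (2 * 2)),
      (m : ℂ) • a - complexBetti.map φ (2 * 2) u ∈ classesSupportedOn X₀ (Set.range i₀.base) (2 * 2) ∧
      IsBlochSemiregular i₀ 4 2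

/-- **`SemiregularRepresentative ⇒ SemiregularBrokenRepresentative`** (PROVED): with no patch (`J = 0`) the broken
cycle is `W₀` itself — `h` a coordinate `xⱼ` not vanishing at the image of a point of `W₀`
(`Motives.exists_X_notMem`), the patch set is empty (`classesSupportedOn_empty`), the ideal clause is `iInf` over
`Fin 0`, purity and the component clause follow from integrality of `W₀` (its generic point is the unique point of
codimension `2`, `Order.coheight_add_one_le`) and the non-ambient hypothesis. [folklore] -/
theorem semiregularBrokenRepresentative_of_semiregularRepresentative (hSR : SemiregularRepresentative) :
    SemiregularBrokenRepresentative := by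
  intro X₀ hX₀ N φ hφ a ha hpp halg hna
  obtain ⟨W₀, i₀, hi₀, hint, hlci, hcod, hcod2, m, hm, u, hsupp, hsr⟩ := hSR hX₀ φ hφ a ha hpp halg hna
  haveI := hint
  obtain ⟨w₂, hw₂⟩ := hcod2
  -- a coordinate not vanishing at `φ (i₀ w₂)`
  obtain ⟨j, hj⟩ := Literature.AlgebraicGeometry.Motives.exists_X_notMem
    (k := ℂ) (n := N) (φ.left.base (i₀.base w₂))
  have hnotin : φ.left.base (i₀.base w₂) ∉ projZero N {MvPolynomial.X j} := by
    intro hmem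
    exact hj ((ProjectiveSpectrum.mem_zeroLocus _ _ _).1 hmem (Set.mem_singleton _))
  -- the empty patch set
  have hPempty : {x : X₀.left | φ.left.base x ∈ projZero N {MvPolynomial.X j} ∧
      ∃ j' : Fin 0, φ.left.base x ∈ projZero N {(Fin.elim0 j' : MvPolynomial (Fin (N + 1)) ℂ)}} = ∅ := by
    ext x
    simp only [Set.mem_setOf_eq, Set.mem_empty_iff_false, iff_false, not_and, not_exists]
    exact fun _ j' => j'.elim0
  -- the generic point of `W₀` is the unique point of codimension `2`
  have hgen : ∀ z : W₀, Order.coheight (i₀.base z) = (2 : ℕ∞) → ∀ w : W₀, i₀.base z ⤳ i₀.base w := by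
    intro z hz w
    have hξz : i₀.base (genericPoint W₀) ⤳ i₀.base z :=
      (genericPoint_specializes z).map i₀.base.hom.continuous
    have hξw : i₀.base (genericPoint W₀) ⤳ i₀.base w :=
      (genericPoint_specializes w).map i₀.base.hom.continuous
    -- `i₀ z ≤ i₀ ξ` in the specialisation order; equality of coheights forces `i₀ ξ ≤ i₀ z`
    have hle : i₀.base z ≤ i₀.base (genericPoint W₀) := hξz
    have hge : i₀.base (genericPoint W₀) ≤ i₀.base z := by
      by_contra hcon
      have hlt : i₀.base z < i₀.base (genericPoint W₀) := lt_of_le_not_ge hle hcon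
      have h1 := Order.coheight_add_one_le hlt
      rw [hz] at h1
      have h2 : (2 : ℕ∞) ≤ Order.coheight (i₀.base (genericPoint W₀)) := hcod _
      have hc : Order.coheight (i₀.base (genericPoint W₀)) ≠ ⊤ := by
        intro htop
        rw [htop, top_add] at h1
        exact absurd h1 (by simp)
      obtain ⟨c, hceq⟩ := ENat.ne_top_iff_exists.1 hc
      rw [← hceq] at h1 h2
      norm_cast at h1 h2
      omega
    have hzξ : i₀.base z ⤳ i₀.base (genericPoint W₀) := hge
    exact hzξ.trans hξw
  have hcodξ : Order.coheight (i₀.base (genericPoint W₀)) = (2 : ℕ∞) := by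
    refine le_antisymm ?_ (hcod _)
    have hle : i₀.base w₂ ≤ i₀.base (genericPoint W₀) :=
      (genericPoint_specializes w₂).map i₀.base.hom.continuous
    exact hw₂ ▸ Order.coheight_anti hle
  refine ⟨W₀, i₀, hi₀, hint, hlci, hcod, ⟨w₂, hw₂⟩, m, hm, u, hsupp, 0, 1, Fin.elim0, MvPolynomial.X j, Fin.elim0,
    Nat.one_pos, fun j' => j'.elim0, MvPolynomial.isHomogeneous_X ℂ j, fun j' => j'.elim0, ⟨w₂, hnotin⟩,
    fun j' => j'.elim0, fun j' => j'.elim0, fun j' => j'.elim0, ?_, W₀, i₀, hi₀, hlci, ?_, ?_, ?_, hsr, ?_⟩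
  · -- ambient clause: the patch set is empty
    change classesSupportedOn X₀ {x : X₀.left | φ.left.base x ∈ projZero N {MvPolynomial.X j} ∧
      ∃ j' : Fin 0, φ.left.base x ∈ projZero N {(Fin.elim0 j' : MvPolynomial (Fin (N + 1)) ℂ)}} (2 * 2) ≤ _
    rw [hPempty, classesSupportedOn_empty]
    exact bot_le
  · -- ideal clause: `⨅` over `Fin 0` is `⊤`
    rw [iInf_of_empty, inf_top_eq]
  · -- set clause
    change Set.range i₀.base = Set.range i₀.base ∪ {x : X₀.left | φ.left.base x ∈ projZero N {MvPolynomial.X j} ∧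
      ∃ j' : Fin 0, φ.left.base x ∈ projZero N {(Fin.elim0 j' : MvPolynomial (Fin (N + 1)) ℂ)}}
    rw [hPempty, Set.union_empty]
  · -- purity: every point specialises from the generic point, of codimension `2`
    intro z
    exact ⟨genericPoint W₀, hcodξ, (genericPoint_specializes z).map i₀.base.hom.continuous⟩
  · -- component clause: the only component is `W₀`, carrying the non-zero class `m·a − φ^*u`
    intro z hz
    refine ⟨(m : ℂ), -u, ?_, ?_⟩
    · have hsub : Set.range i₀.base ⊆ closure {i₀.base z} := by
        rintro _ ⟨w, rfl⟩
        exact specializes_iff_mem_closure.1 (hgen z hz w)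
      have h := classesSupportedOn_mono hsub (2 * 2) hsupp
      simpa [map_neg, sub_eq_add_neg] using h
    · simpa [map_neg, sub_eq_add_neg] using hna u m hm

/-! ## §3 Registered stubs (`sorry` lives ONLY in these five theorems; statements = the defs, unfolded)

Lead's reshape (cycle 1): every registered stub is spelled out over TREE declarations only — the
line-local `HasPolarFamily`, `projZero`, `VHCTwoAffine`, `InPolarScope` are unfolded (with
`attribute [local instance] MvPolynomial.gradedAlgebra` for `ProjectiveSpectrum.zeroLocus`, as in
`Motives/CompleteIntersection`) — so that a worker's `Theorems/….lean` file, which cannot import this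
workfile, can state `theorem stub_<name> : <this signature>` verbatim in
`namespace Summit.HodgeConjecture.HodgeConjecture.Theorems` with the `open` lines of this file; the
`…_holds` bridges below remain definitional unfoldings. -/

section Stubs

/-- STUB S1a, registered form (= the tree's NAMED FACT `HodgeTheory.Bloch1972_semiregularSubschemeLifts`,
Bloch 1972 Thm. (7.1) with the proof of Thm. (7.4) and Artin 1969 Cor. (2.2): an lci closed subscheme of
pure codimension `p` of the anchor fibre of a Hartshorne-projective smooth family over a smooth base,
BLOCH-SEMIREGULAR and with component classes staying of type `(p,p)`, lifts to a FLAT family over an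
étale neighbourhood of the anchor; lead's reshape gen 2: the line's lever S1 is split at this fact,
`PolarAnchoredLifting ⟸ S1a + S1b`). Tier-0 debt of the tree (relative Hilbert schemes / Artin
approximation); listed as a stub because a skeleton may take no unproved hypothesis; closes in one line
when `Bloch1972_semiregularSubschemeLifts_holds` lands. -/
theorem stub_bloch1972Lifts : Bloch1972_semiregularSubschemeLifts := by
  sorry

/-- STUB S1b, registered form (= `SemiregularBrokenRepresentative`, `projZero` unfolded; THE BET of the
line in its ABSOLUTE form, lead's generation 3): every rational `(2,2)` ALGEBRAIC class on a smooth projective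
fourfold `X₀ ⊆ ℙᴺ` has, modulo ambient classes and up to a non-zero rational multiple, a BLOCH-SEMIREGULAR
broken-cycle representative `Z₀ = W₀ ∪ ⋃ C_j` (integral lci `W₀`, complete-intersection patches through
`W₀ ∩ V(h)`), with the bookkeeping clauses the family-side glue consumes. One fourfold, one class, no base:
the card's `C⁺` (asymptotic polar semiregularity) + representative + polar patch. Research-open; NOT implied by
`HodgeConjecture` (semiregularity of a specific subscheme is not a consequence of algebraicity of classes);
first arena: Duque–Villaflor fake linear cycles on the Fermat sextic fourfold. The PROVED glue
`polarLiftOfBloch_of_absolute` turns it, with Bloch's fact (S1a), into the polar family of `HasPolarFamily`. -/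
theorem stub_semiregularBrokenRepresentative :
    ∀ ⦃X₀ : SchemeOver ℂ⦄, IsSmoothProjective 4 X₀ →
      ∀ ⦃N : ℕ⦄ (φ : X₀ ⟶ projectiveSpace N ℂ), IsClosedImmersion φ.left →
      ∀ (a : complexBetti X₀ (2 * 2)), IsRationalClass a → IsOfHodgeType 4 X₀ (2 * 2) 2 2 a →
        a ∈ algebraicClasses X₀ 2 →
      (∀ (u : complexBetti (projectiveSpace N ℂ) (2 * 2)) (m : ℚ), m ≠ 0 →
        (m : ℂ) • a - complexBetti.map φ (2 * 2) u ≠ 0) →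
      ∃ (W₀ : Scheme) (i₀ : W₀ ⟶ X₀.left) (_ : IsClosedImmersion i₀) (_ : IsIntegral W₀)
        (_ : IsFiniteLocallyFree (conormalSheaf i₀))
        (_ : ∀ w : W₀, (2 : ℕ∞) ≤ Order.coheight (i₀.base w))
        (_ : ∃ w : W₀, Order.coheight (i₀.base w) = 2)
        (m : ℚ) (_ : m ≠ 0) (u : complexBetti (projectiveSpace N ℂ) (2 * 2))
        (_ : (m : ℂ) • a - complexBetti.map φ (2 * 2) u ∈ classesSupportedOn X₀ (Set.range i₀.base) (2 * 2))
        (J k : ℕ) (d : Fin J → ℕ) (h : MvPolynomial (Fin (N + 1)) ℂ) (q : Fin J → MvPolynomial (Fin (N + 1)) ℂ)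
        (_ : 0 < k) (_ : ∀ j, 0 < d j) (_ : h.IsHomogeneous k) (_ : ∀ j, (q j).IsHomogeneous (d j))
        (_ : ∃ w : W₀, φ.left.base (i₀.base w) ∉ (ProjectiveSpectrum.zeroLocus (MvPolynomial.homogeneousSubmodule (Fin (N + 1)) ℂ) {h} :
              Set (projectiveSpace N ℂ).left))
        (_ : ∀ (j : Fin J) (w : W₀), φ.left.base (i₀.base w) ∈ (ProjectiveSpectrum.zeroLocus (MvPolynomial.homogeneousSubmodule (Fin (N + 1)) ℂ) {h} :
              Set (projectiveSpace N ℂ).left) →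
              φ.left.base (i₀.base w) ∈ (ProjectiveSpectrum.zeroLocus (MvPolynomial.homogeneousSubmodule (Fin (N + 1)) ℂ) {q j} :
              Set (projectiveSpace N ℂ).left))
        (_ : ∀ j : Fin J, IsIrreducible (φ.left.base ⁻¹' ((ProjectiveSpectrum.zeroLocus (MvPolynomial.homogeneousSubmodule (Fin (N + 1)) ℂ) {h} :
              Set (projectiveSpace N ℂ).left) ∩
              (ProjectiveSpectrum.zeroLocus (MvPolynomial.homogeneousSubmodule (Fin (N + 1)) ℂ) {q j} :
              Set (projectiveSpace N ℂ).left))))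
        (_ : ∀ (j : Fin J) (x : X₀.left),
              φ.left.base x ∈ (ProjectiveSpectrum.zeroLocus (MvPolynomial.homogeneousSubmodule (Fin (N + 1)) ℂ) {h} :
              Set (projectiveSpace N ℂ).left) ∩
              (ProjectiveSpectrum.zeroLocus (MvPolynomial.homogeneousSubmodule (Fin (N + 1)) ℂ) {q j} :
              Set (projectiveSpace N ℂ).left) → (2 : ℕ∞) ≤ Order.coheight x)
        (_ : classesSupportedOn X₀
              {x | φ.left.base x ∈ (ProjectiveSpectrum.zeroLocus (MvPolynomial.homogeneousSubmodule (Fin (N + 1)) ℂ) {h} :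
              Set (projectiveSpace N ℂ).left) ∧ ∃ j : Fin J, φ.left.base x ∈ (ProjectiveSpectrum.zeroLocus (MvPolynomial.homogeneousSubmodule (Fin (N + 1)) ℂ) {q j} :
              Set (projectiveSpace N ℂ).left)} (2 * 2) ≤
            LinearMap.range (complexBetti.map φ (2 * 2)).hom)
        (Z₀ : Scheme) (iZ : Z₀ ⟶ X₀.left) (_ : IsClosedImmersion iZ)
        (_ : IsFiniteLocallyFree (conormalSheaf iZ))
        (_ : iZ.ker = i₀.ker ⊓ ⨅ j : Fin J, (pullback.snd (completeIntersectionι ![h, q j]).left φ.left).ker)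
        (_ : Set.range iZ.base = Set.range i₀.base ∪
              {x | φ.left.base x ∈ (ProjectiveSpectrum.zeroLocus (MvPolynomial.homogeneousSubmodule (Fin (N + 1)) ℂ) {h} :
              Set (projectiveSpace N ℂ).left) ∧ ∃ j : Fin J, φ.left.base x ∈ (ProjectiveSpectrum.zeroLocus (MvPolynomial.homogeneousSubmodule (Fin (N + 1)) ℂ) {q j} :
              Set (projectiveSpace N ℂ).left)})
        (_ : ∀ z : Z₀, ∃ z' : Z₀, Order.coheight (iZ.base z') = (2 : ℕ∞) ∧ iZ.base z' ⤳ iZ.base z)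
        (_ : IsBlochSemiregular iZ 4 2),
        ∀ z : Z₀, Order.coheight (iZ.base z) = (2 : ℕ∞) →
          ∃ (μ : ℂ) (u' : complexBetti (projectiveSpace N ℂ) (2 * 2)),
            μ • a + complexBetti.map φ (2 * 2) u' ∈ classesSupportedOn X₀ (closure {iZ.base z}) (2 * 2) ∧
            μ • a + complexBetti.map φ (2 * 2) u' ≠ 0 := by
  sorry

/-- STUB S2a, registered form (= `FlatFamilyCycleClass`; lead's reshape gen 2, split of S2 at the
classical fact the S2 worker of wave 1 isolated): **the cycle class of a FLAT family of subschemes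
specialises, with a NON-ZERO coefficient on every component of the expected codimension** (Fulton 1998,
Ch. 10, Cor. 10.1 / Prop. 10.2 — principle of continuity: `[𝒲]·[X_t] = [𝒲_t]` with the multiplicities of
the scheme `𝒲_t`, all `≥ 1`; Cor. 19.2 (b): `cl` commutes with these operations; Lemma 19.1.1: `[W₀] ≠ 0`
spans `H^{2p}_{W₀}`). Rendered on real carriers without a cycle class map: for a smooth projective family
`g : 𝒳 ⟶ V` over a smooth `V`, a closed `𝒲 ⊆ 𝒳` flat over `V`, a point `v₀` and a decomposition of the
set of the fibre `𝒲_{v₀} = W₀ ∪ C` into an irreducible closed `W₀` of codimension exactly `p`, not inside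
the closed `C`, everything of codimension `≥ p`: there is ONE global class `Γ ∈ H^{2p}(𝒳(ℂ); ℂ)`
(classically `cl(𝒲)`), algebraic on every fibre, whose restriction to `X₀` is `c₀ • w +` (a class
supported on `C`) with `c₀ ≠ 0` and `0 ≠ w` supported on `W₀`. Now the tree's NAMED FACT `HodgeTheory.fulton1998_flatFamily_cycleClass_specialises`
(`Literature/AlgebraicGeometry/HodgeTheory/FlatFamilyCycleClass.lean`, p137341, proposed by this lead; unproved debt);
registered BY NAME, closes in one line when `…_holds` lands. -/
theorem stub_flatFamilyCycleClass : fulton1998_flatFamily_cycleClass_specialises := by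
  sorry

/-- STUB S2b — **LANDED** (`Summit.HodgeConjecture.HodgeConjecture.Theorems.stub_carriesClassOfCycleClass`, p139363,
wave 2 of the lead's cycle 1, file `Theorems/AnchorTransportVariationalHodgeStubCarriesClassOfCycleClass.lean`, in
the gen-4 SHORT form: Fulton's fact by name, curried reduced polar data, an abstract closed patch set `P` of
codimension `≥ 2` missing a point of `W₀` with ambient supported classes). Glue to the line's shape
`CarriesClassOfCycleClass = FlatFamilyCycleClass → FlatFamilyCarriesClass`: take for `P` the patch set
`{x | φ x ∈ V₊(h) ∧ ∃ j, φ x ∈ V₊(q j)}` of `HasPolarFamily` — closed (preimage of finitely many projective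
zero loci under the continuous `φ`), of codimension `≥ 2` (the patch clause), missing the point of `W₀` off
`V₊(h)`, with ambient supported classes (the gen-2 clause). No `sorry`: this is the tree's theorem. -/
theorem carriesClassOfCycleClass_landed : CarriesClassOfCycleClass := by
  intro hfact 𝒳 S f hf hqp hirr haff hsm A V π hπ v₀ hPF
  obtain ⟨N, e, W₀, i₀, hi₀, hint, _hlci, hcod, hcod2, m, hm, u, hclass, J, k, d, h, q, _hk, _hd, _hh, _hq,
    hnot, _hinc, _hirrj, hcodj, hamb, Z₀, iZ, _hiZ, _hker, hrange, 𝒲, ι, hι, hflat, ε, hcompat⟩ := hPF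
  -- the patch set `P = φ⁻¹(V₊(h)) ∩ ⋃ j, φ⁻¹(V₊(q j))`
  set φ := (fiberι f (AlgPoints.map π v₀) ≫ e).left.base with hφ
  set P : Set (fiberOver f (AlgPoints.map π v₀)).left :=
    {x | φ x ∈ projZero N {h} ∧ ∃ j : Fin J, φ x ∈ projZero N {q j}} with hP
  have hPeq : P = φ ⁻¹' projZero N {h} ∩ ⋃ j : Fin J, φ ⁻¹' projZero N {q j} := by
    ext x
    simp only [hP, Set.mem_setOf_eq, Set.mem_inter_iff, Set.mem_preimage, Set.mem_iUnion]
  have hclosed : ∀ T : Set (MvPolynomial (Fin (N + 1)) ℂ), IsClosed (projZero N T) := fun T =>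
    ProjectiveSpectrum.isClosed_zeroLocus _ T
  have hPc : IsClosed P := by
    rw [hPeq]
    exact ((hclosed {h}).preimage (fiberι f (AlgPoints.map π v₀) ≫ e).left.continuous).inter
      (isClosed_iUnion_of_finite fun j =>
        (hclosed {q j}).preimage (fiberι f (AlgPoints.map π v₀) ≫ e).left.continuous)
  have hcodP : ∀ x ∈ P, (2 : ℕ∞) ≤ Order.coheight x := fun x hx => by
    obtain ⟨hxh, j, hxj⟩ := hx
    exact hcodj j x ⟨hxh, hxj⟩
  have hnotP : ∃ w : W₀, i₀.base w ∉ P := by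
    obtain ⟨w, hw⟩ := hnot
    exact ⟨w, fun hwP => hw hwP.1⟩
  exact Summit.HodgeConjecture.HodgeConjecture.Theorems.stub_carriesClassOfCycleClass hfact f hf hqp hirr haff
    hsm A V π hπ v₀ N e W₀ i₀ hi₀ hint hcod hcod2 m hm u hclass P hPc hcodP hnotP hamb Z₀ iZ hrange 𝒲 ι hι hflat
    ε hcompat

/-- STUB S3 — **LANDED** (`Summit.HodgeConjecture.HodgeConjecture.Theorems.stub_dominanceAlongSmooth`,
p135546, wave 1 of the lead's cycle 1, file `Theorems/AnchorTransportVariationalHodgeStubDominanceAlongSmooth.lean`):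
openness of smooth morphisms (`UniversallyOpen.of_flat`), Nullstellensatz lift of complex points inside `U`,
and `Theorems.dominanceForm_of_isQuasiProjectiveOver` with the discharged
`charlesSchnell_algebraicityLocus_iUnion_closed_holds`. No `sorry`: this is the tree's theorem. -/
theorem dominanceAlongSmooth_landed : DominanceAlongSmooth :=
  Summit.HodgeConjecture.HodgeConjecture.Theorems.stub_dominanceAlongSmooth

/-- STUB S4a — **LANDED** (`Summit.HodgeConjecture.HodgeConjecture.Theorems.stub_pencilSweep`, p137114,
lead's cycle 1, file `Theorems/AnchorTransportVariationalHodgePencilSweep.lean`, proof by the S4 worker of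
wave 1): the pencil sweep back to `X`. No `sorry`: this is the tree's theorem. -/
theorem pencilSweep_landed : PencilSweep :=
  fun hX ι _ _ ha hXt _ hT hTne hfib _ hpm hIH c halg =>
    Summit.HodgeConjecture.HodgeConjecture.Theorems.stub_pencilSweep hX ι ha hXt hT hTne hfib hpm hIH c halg

/-- STUB S4h — **LANDED** (`Summit.HodgeConjecture.HodgeConjecture.Theorems.stub_hDirection`, p139049, wave 2 of
the lead's cycle 1, file `Theorems/AnchorTransportVariationalHodgeHDirection.lean`): the `H`-direction of Thomas's
descent (`V₂(m)` along the smooth family of a pencil over an open of `ℙ¹`, from one good member to all). No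
`sorry`: this is the tree's theorem. -/
theorem hDirection_landed : HDirection :=
  fun hX hV₂ ι _ a hXt V hsm hfib c hc hpp _ ht₁ halg₁ t ht =>
    Summit.HodgeConjecture.HodgeConjecture.Theorems.stub_hDirection hX hV₂ ι a hXt V hsm hfib c hc hpp ht₁
      halg₁ t ht

/-- STUB S4b — **LANDED** (`Summit.HodgeConjecture.HodgeConjecture.Theorems.stub_thomasDescentOfSweep`, wave 1 of the
lead's cycle 2, worker w-thomas, file `Theorems/AnchorTransportVariationalHodgeStubThomasDescentOfSweep.lean`): Thomas's
hyperplane descent `n ≥ 5 ⇒ n = 4` given the sweep (the `H`-direction hypothesis turned out to be unnecessary on the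
product-base route: the family `g : 𝒴 ⟶ S × (ℙᴺ)^*` of ALL hyperplane sections of ALL fibres over its good locus is a
smooth projective family of `(n-1)`-folds with quasi-projective total space, anchored at a good section of `X_{s₀}`; `V₂(n-1)`
makes `A` algebraic on every good section; a good pencil of `X_s` has its good members among them; the sweep with
Lefschetz `(1,1)` concludes). No `sorry`: this is the tree's theorem. -/
theorem thomasDescentOfSweep_landed : ThomasDescentOfSweep :=
  fun hS hH => Summit.HodgeConjecture.HodgeConjecture.Theorems.stub_thomasDescentOfSweep hS hH

/-- STUB C₂, registered form (= `VariationalHodgeTwoProper` = the strategist's CODIM-SPLIT child VERBATIM; generation 7,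
lead c3-0; replaces with C₃ the former S5 `stub_residualOffPolarScope`): the crux at `p = 2`, `n ≥ 4`, NON-quasi-projective total
space, smooth irreducible affine curve bases. Crux-sized; NOT delegated; to be PROMOTED by the route planner
(`route edit --split VariationalHodge`, package `Cruxes/VariationalHodge/CODIM-SPLIT.md`). -/
theorem stub_twoProperResidual :
    ∀ ⦃n : ℕ⦄ ⦃𝒳 S : SchemeOver ℂ⦄ (f : 𝒳 ⟶ S), IsSmoothProjectiveFamily f n →
      ¬ (∃ (P : SchemeOver ℂ) (j : 𝒳 ⟶ P), IsProjectiveOver P ∧ IsOpenImmersion j.left) →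
      IrreducibleSpace S.left → IsAffine S.left → AlgebraicGeometry.Smooth S.hom →
      topologicalKrullDim S.left = 1 → 4 ≤ n →
      ∀ (A : complexBetti 𝒳 (2 * 2)),
      (∀ s : ComplexPoints S, IsRationalClass (complexBetti.map (fiberι f s) (2 * 2) A) ∧
        IsOfHodgeType n (fiberOver f s) (2 * 2) 2 2 (complexBetti.map (fiberι f s) (2 * 2) A)) →
      (∃ s₀ : ComplexPoints S,
        complexBetti.map (fiberι f s₀) (2 * 2) A ∈ algebraicClasses (fiberOver f s₀) 2) →
      ∀ s : ComplexPoints S,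
        complexBetti.map (fiberι f s) (2 * 2) A ∈ algebraicClasses (fiberOver f s) 2 := by
  sorry

/-- STUB C₃, registered form (= `VariationalHodgeHigherCodim` = the strategist's CODIM-SPLIT child VERBATIM; generation 7,
lead c3-0): the crux in codimensions `3 ≤ p ≤ n - 2` over smooth irreducible affine curve bases — the open remainder of
Grothendieck's conjecture. Crux-sized; NOT delegated; to be PROMOTED. -/
theorem stub_higherCodimResidual :
    ∀ ⦃n : ℕ⦄ ⦃𝒳 S : SchemeOver ℂ⦄ (f : 𝒳 ⟶ S), IsSmoothProjectiveFamily f n →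
      IrreducibleSpace S.left → IsAffine S.left → AlgebraicGeometry.Smooth S.hom →
      topologicalKrullDim S.left = 1 →
      ∀ (p : ℕ), 3 ≤ p → p + 2 ≤ n →
      ∀ (A : complexBetti 𝒳 (2 * p)),
      (∀ s : ComplexPoints S, IsRationalClass (complexBetti.map (fiberι f s) (2 * p) A) ∧
        IsOfHodgeType n (fiberOver f s) (2 * p) p p (complexBetti.map (fiberι f s) (2 * p) A)) →
      (∃ s₀ : ComplexPoints S,
        complexBetti.map (fiberι f s₀) (2 * p) A ∈ algebraicClasses (fiberOver f s₀) p) →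
      ∀ s : ComplexPoints S,
        complexBetti.map (fiberι f s) (2 * p) A ∈ algebraicClasses (fiberOver f s) p := by
  sorry

/-! ### Consistency: each named statement IS its registered stub (definitional unfolding only) -/

theorem bloch1972Lifts_holds : Bloch1972_semiregularSubschemeLifts := stub_bloch1972Lifts
theorem semiregularBrokenRepresentative_holds : SemiregularBrokenRepresentative :=
  stub_semiregularBrokenRepresentative
theorem polarLiftOfBloch_holds : PolarLiftOfBloch :=
  polarLiftOfBloch_of_absolute semiregularBrokenRepresentative_holds
theorem polarAnchoredLifting_holds : PolarAnchoredLifting := polarLiftOfBloch_holds bloch1972Lifts_holds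
theorem flatFamilyCycleClass_holds : FlatFamilyCycleClass := stub_flatFamilyCycleClass
theorem carriesClassOfCycleClass_holds : CarriesClassOfCycleClass := carriesClassOfCycleClass_landed
theorem flatFamilyCarriesClass_holds : FlatFamilyCarriesClass :=
  carriesClassOfCycleClass_holds flatFamilyCycleClass_holds
theorem dominanceAlongSmooth_holds : DominanceAlongSmooth := dominanceAlongSmooth_landed
theorem pencilSweep_holds : PencilSweep := pencilSweep_landed
theorem hDirection_holds : HDirection := hDirection_landed
theorem thomasDescentOfSweep_holds : ThomasDescentOfSweep := thomasDescentOfSweep_landed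
theorem reductionToFourfoldsTwo_holds : ReductionToFourfoldsTwo :=
  thomasDescentOfSweep_holds pencilSweep_holds hDirection_holds
theorem twoProperResidual_holds : VariationalHodgeTwoProper := stub_twoProperResidual
theorem higherCodimResidual_holds : VariationalHodgeHigherCodim := stub_higherCodimResidual
theorem residualOffPolarScope_holds : ResidualOffPolarScope :=
  residualOffPolarScope_of_children twoProperResidual_holds higherCodimResidual_holds

end Stubs

/-! ### Name-keyed aliases (the skeleton audit matches a hypothesis head to a declared stub by its last
name component) -/
namespace Registered

/-- Alias of the Bloch fact keyed by the registered stub name. -/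
abbrev stub_bloch1972Lifts : Prop := Bloch1972_semiregularSubschemeLifts
/-- Alias of `SemiregularBrokenRepresentative` keyed by the registered stub name. -/
abbrev stub_semiregularBrokenRepresentative : Prop := SemiregularBrokenRepresentative
/-- Alias of `FlatFamilyCycleClass` keyed by the registered stub name. -/
abbrev stub_flatFamilyCycleClass : Prop := FlatFamilyCycleClass
/-- Alias of `VariationalHodgeTwoProper` (child C₂) keyed by the registered stub name. -/
abbrev stub_twoProperResidual : Prop := VariationalHodgeTwoProper
/-- Alias of `VariationalHodgeHigherCodim` (child C₃) keyed by the registered stub name. -/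
abbrev stub_higherCodimResidual : Prop := VariationalHodgeHigherCodim

end Registered

/-! ## §4 Composition (no `sorry` below this line) -/

section Composition

/-- **THE FOURFOLD CASE — the line proper** (kernel-checked from S1, S2, S3): `V₂` over smooth
irreducible affine bases for families of fourfolds with quasi-projective total space. S1 gives a
smooth `π : V ⟶ S`, `v₀ ↦ s₀`, and a polar family for `pr^*A` on `𝒳 ×_S V ⟶ V` at `v₀`; S2 makes
`pr^*A` algebraic on the fibres over a Zariski open `U ∋ v₀` of `V`, i.e. (landed base-change
invariance `Theorems.map_fiberι_familyPullback_mem_algebraicClasses_iff`) `A` algebraic on `𝒳_{π t'}`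
for `t'` over `U`; S3 spreads this to every complex point of `S`. -/
theorem vhcTwoAffine_four (hS1 : PolarAnchoredLifting) (hS2 : FlatFamilyCarriesClass) :
    VHCTwoAffine 4 := by
  intro 𝒳 S f hf hqp hirr haff hsm A hA hs₀ s
  obtain ⟨s₀, hs₀⟩ := hs₀
  haveI := hirr
  haveI := haff
  haveI := hsm
  by_cases hamb : ∃ (N : ℕ) (e : 𝒳 ⟶ projectiveSpace N ℂ) (u : complexBetti (projectiveSpace N ℂ) (2 * 2))
      (m : ℚ), m ≠ 0 ∧ (m : ℂ) • complexBetti.map (fiberι f s₀) (2 * 2) A -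
        complexBetti.map (fiberι f s₀ ≫ e) (2 * 2) u = 0
  · -- AMBIENT ANCHOR CLASS (gen 3, proved): `m • A - e^* u` vanishes on `X_{s₀}`, hence on every fibre
    -- (rigidity), and `A|_{X_s} = m⁻¹ • (e^* u)|_{X_s}` is algebraic by the moving lemma; no lever needed.
    obtain ⟨N, e, u, m, hm, h0⟩ := hamb
    haveI : IsAffineHom S.hom := inferInstance
    haveI : IsSeparated S.hom := inferInstance
    haveI : CompactSpace S.left := isCompact_univ_iff.mp (isAffineOpen_top S.left).isCompact
    have hres : ∀ t : ComplexPoints S,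
        complexBetti.map (fiberι f t) (2 * 2) ((m : ℂ) • A - complexBetti.map e (2 * 2) u) =
          (m : ℂ) • complexBetti.map (fiberι f t) (2 * 2) A - complexBetti.map (fiberι f t ≫ e) (2 * 2) u := by
      intro t
      rw [map_sub, map_smul, complexBetti.map_comp (fiberι f t) e]
      rfl
    have hs : (m : ℂ) • complexBetti.map (fiberι f s) (2 * 2) A -
        complexBetti.map (fiberι f s ≫ e) (2 * 2) u = 0 := by
      rw [← hres s, complexBetti_map_fiberι_eq_of_eq f hf (2 * 2) ((m : ℂ) • A - complexBetti.map e (2 * 2) u)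
        0 s₀ s (by rw [hres s₀, h0, map_zero]), map_zero]
    rw [sub_eq_zero] at hs
    have hmC : (m : ℂ) ≠ 0 := by exact_mod_cast hm
    have halg : (m : ℂ) • complexBetti.map (fiberι f s) (2 * 2) A ∈ algebraicClasses (fiberOver f s) 2 := by
      rw [hs]
      exact map_projectiveSpace_mem_algebraicClasses (hf.isSmoothProjective s) (fiberι f s ≫ e) 2 u
    have h := Submodule.smul_mem (algebraicClasses (fiberOver f s) 2) (m : ℂ)⁻¹ halg
    rwa [smul_smul, inv_mul_cancel₀ hmC, one_smul] at h
  · push Not at hamb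
    obtain ⟨V, π, hπ, v₀, -, hPF⟩ := hS1 f hf hqp hirr haff hsm A hA s₀ hs₀
      (fun N e u m hm => hamb N e u m hm)
    obtain ⟨U, hUo, hv₀U, halg⟩ := hS2 f hf hqp hirr haff hsm A V π hπ v₀ hPF
    exact dominanceAlongSmooth_landed f hf hqp hirr haff hsm 2 A V π hπ U hUo ⟨v₀.pt, hv₀U⟩ halg s

/-- **`V₂` in relative dimension `n ≤ 3` is FREE** (lead's reshape, cycle 1): for `n ≤ 3` the
codimension `2` lies in the Lefschetz range (`n ≤ 1`: `2 > n`; `n = 2`: top degree; `n = 3`: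
`p = n - 1`), where the conclusion holds fibre by fibre by `Theorems.variationalHodge_of_dim_le_three`,
now unconditional (`lefschetzOneOne_rational_holds`, `nonempty_hardLefschetzNFold_holds`). No anchor,
no quasi-projectivity, no affineness is used. -/
theorem vhcTwoAffine_of_le_three {n : ℕ} (hn : n ≤ 3) : VHCTwoAffine n :=
  fun _ _ f hf _ _ _ _ A hA _ s =>
    variationalHodge_of_dim_le_three lefschetzOneOne_rational_holds nonempty_hardLefschetzNFold_holds
      hn f hf 2 A hA s

/-- **The residual-free SCOPE THEOREM** (the line's own reach, for a lead who prefers to audit it: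
`ledger skeleton check … --crux-decl
Summit.HodgeConjecture.HodgeConjecture.Cruxes.VariationalHodge.PolarPatchBrokenCycles.VariationalHodgeTwoAffineAll`):
S1–S4 imply `V₂` over affine bases with quasi-projective total space in EVERY relative dimension
(`n ≤ 3` free, `n = 4` the line `vhcTwoAffine_four`, `n ≥ 5` Thomas's descent S4). -/
theorem VariationalHodgeTwoAffineAll_of (hS1a : Registered.stub_bloch1972Lifts)
    (hS1b : Registered.stub_semiregularBrokenRepresentative) (hS2a : Registered.stub_flatFamilyCycleClass) :
    VariationalHodgeTwoAffineAll :=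
  -- generation 8: the tree's `Theorems.polarPatch_vhcTwo_all` (p156143) IS this composition
  fun n => Summit.HodgeConjecture.HodgeConjecture.Theorems.polarPatch_vhcTwo_all hS1b hS1a hS2a n

/-- The in-file composition of generations 3–7 (kept as a second certificate): `n ≤ 3` free, `n = 4` the line
`vhcTwoAffine_four`, `n ≥ 5` Thomas's descent S4. -/
theorem VariationalHodgeTwoAffineAll_of' (hS1a : Registered.stub_bloch1972Lifts)
    (hS1b : Registered.stub_semiregularBrokenRepresentative) (hS2a : Registered.stub_flatFamilyCycleClass) :
    VariationalHodgeTwoAffineAll := by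
  have hS1 : PolarAnchoredLifting := polarLiftOfBloch_of_absolute hS1b hS1a
  have hS2 : FlatFamilyCarriesClass := carriesClassOfCycleClass_landed hS2a
  have hS4 : ReductionToFourfoldsTwo := thomasDescentOfSweep_landed pencilSweep_landed hDirection_landed
  intro n
  rcases le_or_gt n 3 with hn | hn
  · exact vhcTwoAffine_of_le_three hn
  rcases Nat.lt_or_ge 4 n with hn5 | hn4
  · exact hS4 (vhcTwoAffine_four hS1 hS2) n hn5
  · obtain rfl : n = 4 := le_antisymm hn4 hn
    exact vhcTwoAffine_four hS1 hS2

/-- **`VariationalHodge_of` — THE SKELETON THEOREM (generation 8: one line of the tree).** The five registered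
stubs imply the crux `AnchorTransport.VariationalHodge` BY NAME, through the landed
`Theorems.variationalHodge_of_polarPatchInputs` (p156143: the bet → Bloch's fact → Fulton's fact → C₂ → C₃ →
`VariationalHodge`; inside it: `Theorems.polarPatch_vhcTwo_all` for the scope `p = 2 ∧ quasi-projective total
space`, and the strategist's glue `Theorems.variationalHodge_of_codimSplit` for the reduction to curve bases, the
middle range and the case split). -/
theorem VariationalHodge_of (hS1a : Registered.stub_bloch1972Lifts)
    (hS1b : Registered.stub_semiregularBrokenRepresentative) (hS2a : Registered.stub_flatFamilyCycleClass)
    (hC2 : Registered.stub_twoProperResidual) (hC3 : Registered.stub_higherCodimResidual) :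
    VariationalHodge :=
  Summit.HodgeConjecture.HodgeConjecture.Theorems.variationalHodge_of_polarPatchInputs hS1b hS1a hS2a hC2 hC3

/-- The in-file composition of generation 7 (kept as a second certificate): curve-base/middle-range reduction
`Theorems.variationalHodge_of_residual`, case split on the scope, residual = the two children. -/
theorem VariationalHodge_of' (hS1a : Registered.stub_bloch1972Lifts)
    (hS1b : Registered.stub_semiregularBrokenRepresentative) (hS2a : Registered.stub_flatFamilyCycleClass)
    (hC2 : Registered.stub_twoProperResidual) (hC3 : Registered.stub_higherCodimResidual) :
    VariationalHodge := by
  have hS5 : ResidualOffPolarScope := residualOffPolarScope_of_children hC2 hC3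
  refine variationalHodge_of_residual lefschetzOneOne_rational_holds nonempty_hardLefschetzNFold_holds
    mumford_smoothCurve_through_two_points_holds
    fun n 𝒳 S f hf hirr haff hsm hdim p hp2 hpn A hA hs₀ s => ?_
  by_cases hscope : InPolarScope p 𝒳
  · obtain ⟨rfl, hqp⟩ := hscope
    exact VariationalHodgeTwoAffineAll_of' hS1a hS1b hS2a n f hf hqp hirr haff hsm A hA hs₀ s
  · exact hS5 f hf hirr haff hsm hdim p hp2 hpn hscope A hA hs₀ s

/-- **ROUTE-SPLIT CERTIFICATE (for the planner; no stubs involved).** The crux is EQUIVALENT to the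
conjunction of the line's residual-free scope theorem `VariationalHodgeTwoAffineAll` (`p = 2`, quasi-projective
total space, smooth irreducible affine bases, every relative dimension) and the residual `ResidualOffPolarScope`
(the crux verbatim for `2 ≤ p ≤ n - 2` off the scope `p = 2 ∧ IsQuasiProjectiveOver 𝒳`, over smooth irreducible
affine curve bases): `→` is restriction; `←` is the unconditional curve-base/middle-range reduction
`Theorems.variationalHodge_of_residual` (discharged Lefschetz `(1,1)`, hard Lefschetz, Mumford facts) and the case
split on the scope. So `route edit --split VariationalHodge` into these two children loses nothing (lead c1-0's
`RouteSplitProposal.lean`, re-certified here in the tree by lead c2-0). -/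
theorem variationalHodge_iff_twoAffineAll_and_residual :
    VariationalHodge ↔ (VariationalHodgeTwoAffineAll ∧ ResidualOffPolarScope) := by
  constructor
  · intro hV
    exact ⟨fun n 𝒳 S f hf _ hirr _ hsm A hA hs₀ s => hV f hf hirr hsm 2 A hA hs₀ s,
      fun n 𝒳 S f hf hirr _ hsm _ p _ _ _ A hA hs₀ s => hV f hf hirr hsm p A hA hs₀ s⟩
  · rintro ⟨hTwo, hRes⟩
    refine variationalHodge_of_residual lefschetzOneOne_rational_holds nonempty_hardLefschetzNFold_holds
      mumford_smoothCurve_through_two_points_holds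
      fun n 𝒳 S f hf hirr haff hsm hdim p hp2 hpn A hA hs₀ s => ?_
    by_cases hscope : InPolarScope p 𝒳
    · obtain ⟨rfl, hqp⟩ := hscope
      exact hTwo n f hf hqp hirr haff hsm A hA hs₀ s
    · exact hRes f hf hirr haff hsm hdim p hp2 hpn hscope A hA hs₀ s

/-- **THREE-WAY ROUTE-SPLIT CERTIFICATE (generation 7; = the strategist's `variationalHodge_iff_codimSplit` with the
line's names).** The crux is EQUIVALENT to `C₁ ∧ C₂ ∧ C₃` with `C₁ = VariationalHodgeTwoAffineAll` (the line's residual-free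
reach: `p = 2`, quasi-projective total space, smooth irreducible affine bases, every `n`), `C₂ = VariationalHodgeTwoProper`,
`C₃ = VariationalHodgeHigherCodim`. The line proper is `C₁ ⟸ S1a + S1b + S2a` (`VariationalHodgeTwoAffineAll_of`); C₂ and C₃ are
the two stubs a planner promotes. [cite: CharlesSchnell2014Notes, Conj. 11.3.1 and Cor. 11.3.6] -/
theorem variationalHodge_iff_threeChildren :
    VariationalHodge ↔ (VariationalHodgeTwoAffineAll ∧ VariationalHodgeTwoProper ∧ VariationalHodgeHigherCodim) := by
  rw [variationalHodge_iff_twoAffineAll_and_residual, residualOffPolarScope_iff_children]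

/-- Wiring check: the registered stubs feed the composition as stated (definitional unfolding only;
this theorem depends on the five `sorry`s and on nothing else). -/
theorem variationalHodge_holds_of_stubs : VariationalHodge :=
  VariationalHodge_of stub_bloch1972Lifts stub_semiregularBrokenRepresentative stub_flatFamilyCycleClass
    stub_twoProperResidual stub_higherCodimResidual

/-- Wiring check for the residual-free reach. -/
theorem variationalHodgeTwoAffineAll_holds_of_stubs : VariationalHodgeTwoAffineAll :=
  VariationalHodgeTwoAffineAll_of stub_bloch1972Lifts stub_semiregularBrokenRepresentative stub_flatFamilyCycleClass

end Composition

end Summit.HodgeConjecture.HodgeConjecture.Cruxes.VariationalHodge.PolarPatchBrokenCycles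

end
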